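import Literature.Probability.RandomPlanarGeometry.HexSAWStripSurfaceGrowthBounds
import Literature.Probability.RandomPlanarGeometry.HexSAWStripSurfaceGrowthStrict
import Literature.Probability.RandomPlanarGeometry.HexSAWStripSurfaceMonotone
import Literature.Probability.RandomPlanarGeometry.HexSAWStripSurfaceThresholdClasses
import Literature.Probability.RandomPlanarGeometry.HexSAWStripSurfaceArchRadius
import Literature.Probability.RandomPlanarGeometry.HexSAWStripSurfaceRadius
import HarnessLib

/-!
# ONE-CAR edition «THRESHOLD+» (a-p2 g13, 2026-08-24): `HexSAWStripSurfaceThresholdRate` ⊕ «THRESHOLD-DIVERGENCE-RATE» ⊕ «ARCH-COEFFICIENTS» ⊕ «SERIES-CONTINUITY»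

Filing shape per lead g14 r17/r18 (GENERAL one-car rule for CLASS-D chains while the olean builder runs in bursts without backfill,
OPS R13): the four banked HOME modules of the a-p2 lane that sit behind the unbuilt tree parents `HexSAWStripSurfaceArchRadius` /
`HexSAWStripSurfaceGrowthBounds` are filed as ONE module instead of a three-level chain (THRESHOLD → {R, AC} → SC).  Bodies VERBATIM,
in dependency order; only the `import` lines of the parts are hoisted/deduplicated (the two internal imports dropped).  Provenance by
sha16: PART I–III = `pub-sawmu-a-p2/g12/threshold/HexSAWStripSurfaceThresholdRate_merged_ed1_306dda43b3707f4d.lean` (itself C ed.3 ⊕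
E ed.3 ⊕ F ed.4 verbatim, lead g13 r12 (2) NO VETO); PART IV = `…/HexSAWStripSurfaceThresholdDivergenceRate_ed5_d70fde2f7f2ccf58.lean`;
PART V = `pub-sawmu-a-p2/g11/archcoeff/HexSAWStripSurfaceArchCoefficients_ed1_ff3f68259c53d8a5.lean`; PART VI =
`…/HexSAWStripSurfaceSeriesContinuity_ed2_08341af99213b1f8.lean`.  Cells of record carry part-wise by name (kits `g12/threshold/THRESHOLD-KIT.md`,
`g11/FILING-README.md`).  Kind: definition (PART V declares the arch-coefficient `def`s).  Each part keeps its own module docstring below.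
-/

/- ═════ ONE-CAR edition: begin PART I–III «THRESHOLD» merged ed.1 306dda43b3707f4d (a-p2 g10/g11/g12; = C ed.3 ⊕ E ed.3 ⊕ F ed.4) — body VERBATIM (imports hoisted) ═════ -/

/-!
# The strip threshold `y_T` (BBdGDCG14, Corollary 8): `ν_T(y_T) = x_c⁻¹` and `y_{T+1} < y_T`; the limits `A_T, B_T` below `y_T`;
# the divergence of the strip series AT `y_T` — ONE MODULE (merged edition)

Merged edition (lane «pcv-sawmu», a-p2 g12, 2026-08-24): this file is the byte-verbatim concatenation, in this order, of three
kernel-checked HOME modules of the a-p2 lineage whose only mutual dependence was by `import` —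
PART 1 = «THRESHOLD-RATE» (formerly this module alone, ed.3), PART 2 = «LIMITS-FULL» (formerly `HexSAWStripSurfaceLimitsFull.lean`,
ed.3), PART 3 = «THRESHOLD-DIVERGENCE» (formerly `HexSAWStripSurfaceThresholdDivergence.lean`, ed.4) — with their `import` lines hoisted
(the two internal imports dropped) and NOTHING else changed: every declaration, proof and docstring below is the part's own.  Reason: one
tree module instead of a three-deep import chain (each link of which waits for the previous link's build), so that the dependants
(«THRESHOLD-DIVERGENCE-RATE», «SERIES-CONTINUITY», «HEX-YT-WINDOW», «HEX-STRIP-THRESHOLD-UNIQUE», a-idea-1's «FRAME BRIDGE») sit one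
level above the tree parents `HexSAWStripSurfaceGrowthBounds` / `…GrowthStrict` / `…ArchRadius`.  Each part keeps its own module
docstring (below, as a section docstring) with its sources, statement list and label of record.
-/


/-! ## PART 1 — C «THRESHOLD-RATE» ed.3 f7c1aa4c028e754c (a-p2 g10/g11) (verbatim) -/

/-!
# `ν_T(y_T) = x_c⁻¹` and `y_{T+1} < y_T`, `y* < y_T` for every `T` (BBdGDCG14, Corollary 8 — the defining clause
# `ρ_T(y_T) = x_c` and the STRICT monotonicity of the strip thresholds, for the lane's `y_T`, unconditionally)

Topic `Literature/Probability/RandomPlanarGeometry` (continues `HexSAWStripSurfaceGrowthBounds.lean` — `HV.stripNu_le_inv_of_mem`,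
`HV.inv_le_stripNu_of_stripYT_lt`, `HV.mem_stripBddSet_of_stripNu_lt` —, `HexSAWStripSurfaceGrowthStrict.lean` —
`HV.stripNu_lt_succ : ν_T(y) < ν_{T+1}(y)` for `y ≥ 1` —, the moduli `HV.stripNu_scale_le` / `HV.stripNu_mono_y` of
`HexSAWStripSurfaceGrowth.lean`, and `HexSAWStripSurfaceMonotone.lean`: `HV.stripBddSet_succ_subset`, `HV.stripYT_succ_le`
(`y_{T+1} ≤ y_T`); capstone tokens `HV.yStar_le_stripYT`, `HV.yStar_pos`, `HV.mem_stripBddSet_of_lt`, `HV.stripGFy_mono`).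
Source: N. R. Beaton, M. Bousquet-Mélou, J. de Gier, H. Duminil-Copin, A. J. Guttmann, *The critical fugacity for surface adsorption of
self-avoiding walks on the honeycomb lattice is `1 + √2`*, Comm. Math. Phys. 326 (2014) 727–754, arXiv:1109.0358v5, Corollary 8
(p. 12): "There exists a unique `y_T > 0` such that `ρ_T(y_T) = x_c := 1/μ`. The series (in `y`) `A_T(x_c,y)`, `B_T(x_c,y)` and
`C_T(x_c,y)` have radius of convergence `y_T`, and `y_T` decreases to the critical fugacity `y_c` as `T` goes to infinity", proof
(p. 13): "since `ρ_T(y_T) = x_c` and `ρ_{T+1}(y) < ρ_T(y)` (Proposition 7), we have `ρ_{T+1}(y_T) < x_c` and thus `y_{T+1} < y_T`.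
Hence the sequence `(y_T)_{T ≥ 1}` decreases. … and thus `y_T > y_c` for all `T`".

## What is proved (namespace `Literature.Probability.RandomPlanarGeometry.SAW.HV`; `T ≥ 1`; standard axioms)

* `stripBddSet_add_subset`, **`mem_stripBddSet_of_lt_stripYT_of_le`** (`0 ≤ y < y_T`, `1 ≤ h ≤ T ⇒ y ∈ stripBddSet h`; ed.3 name —
  the tree's `HexSAWStripSurfaceRadius.lean` owns `HV.mem_stripBddSet_of_lt_stripYT` for the case `h = T`),
  **`stripNu_le_inv_of_lt_stripYT`** (`0 < y < y_T ⇒ ν_T(y) ≤ x_c⁻¹`), `stripYT_pos`, `one_le_stripYT`, `le_stripYT_of_stripNu_lt`,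
  `stripYT_le_of_inv_lt_stripNu`;
* ★ **`stripNu_stripYT : ν_T(y_T) = x_c⁻¹`** — Corollary 8's "`ρ_T(y_T) = x_c`" for the LANE's `y_T` (`HV.stripYT`, the boundedness
  threshold of the critical `y`-weighted bridge class) and the lane's translation-class rate `ν_T` (`HV.stripNu`);
* ★★ **`stripYT_succ_lt : stripYT (T+1) < stripYT T`**, `strictAnti_stripYT_succ`, ★★ **`yStar_lt_stripYT : yStar < stripYT T`** —
  UNCONDITIONAL (the tree had the weak forms `stripYT_succ_le`, `yStar_le_stripYT`);
* ★★ **`log_stripYT_succ_add_le`** / **`stripYT_succ_mul_le`** — an EXPLICIT RATE of strict decrease (not in print):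
  `y_{T+1} (1 + (y_T x_c⁻¹)^{-(4T+4)})^{1/(2T)} ≤ y_T`; `one_lt_stripYT`, `stripNu_one_le_inv`, `stripNu_le_mul_inv`.

Label: CONSOLIDATION BY A DIFFERENT PROOF (the printed proof runs through unfolded arches, rationality of the strip series and the
common radius of `A_T, B_T, C_T`; here: the lane's finite bridge decomposition inside the strip, the scaling modulus of `ν_T`, and the
four-column insertion for the top-level weight), for the lane's objects; the identification of the lane's `y_T` with the printed
`y_T` is the capstone's READING (`HexSAWSurfaceFugacity.lean`), not asserted here.  Lane «pcv-sawmu», a-p2 g10.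
-/

noncomputable section

open Finset Filter Topology Literature.Probability.LatticeModels Literature.Probability.Percolation SimpleGraph

namespace Literature.Probability.RandomPlanarGeometry.SAW.HV

/-! ## The threshold `y_T` and the growth rate: `ν_T(y_T) = x_c⁻¹`, and the strict monotonicity `y_{T+1} < y_T` -/

section Threshold

variable {T : ℕ}

/-- `stripBddSet (h + d) ⊆ stripBddSet h` (`h ≥ 1`): iterate the one-row lift. [cite: BeatonBousquetMelouDeGierDuminilCopinGuttmann2014, Corollary 8 (arXiv v5 p. 12: y_T decreases)] -/
theorem stripBddSet_add_subset {h : ℕ} (hh : 1 ≤ h) (d : ℕ) : stripBddSet (h + d) ⊆ stripBddSet h := by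
  induction d with
  | zero => exact fun y hy => hy
  | succ d ih => exact (stripBddSet_succ_subset (T := h + d) (by omega)).trans ih

/-- **Below the threshold every lower strip is bounded**: `0 ≤ y < y_T`, `1 ≤ h ≤ T ⇒ y ∈ stripBddSet h`.
[cite: BeatonBousquetMelouDeGierDuminilCopinGuttmann2014, Corollary 8 (arXiv v5 p. 12: y_{T+1} < y_T, so B_h(x_c; y) < ∞ for y < y_T, h ≤ T)] -/
theorem mem_stripBddSet_of_lt_stripYT_of_le (hT : 1 ≤ T) {y : ℝ} (hy : 0 ≤ y) (hlt : y < stripYT T) {h : ℕ} (h1 : 1 ≤ h)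
    (h2 : h ≤ T) : y ∈ stripBddSet h := by
  have hne : (stripBddSet T).Nonempty := ⟨yStar / 2, mem_stripBddSet_of_lt hT (half_pos yStar_pos) (half_lt_self yStar_pos)⟩
  obtain ⟨y', hy'mem, hyy'⟩ := exists_lt_of_lt_csSup hne hlt
  have hyT : y ∈ stripBddSet T := by
    obtain ⟨K, hK⟩ := hy'mem.2
    refine ⟨hy, ⟨K, ?_⟩⟩
    rintro _ ⟨L, rfl⟩
    exact (stripGFy_mono T L (IsBetaDart T) hy hyy'.le).trans (hK ⟨L, rfl⟩)
  obtain ⟨d, rfl⟩ := Nat.exists_eq_add_of_le h2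
  exact stripBddSet_add_subset h1 d hyT

/-- **(a) Below the threshold the growth rate is at most `μ_ℍ`**: `0 < y < y_T ⇒ ν_T(y) ≤ x_c⁻¹`.
[cite: BeatonBousquetMelouDeGierDuminilCopinGuttmann2014, Corollary 8 (arXiv v5 p. 12: "ρ_T(y) > ρ_T(y_T) ⟺ y < y_T" with ρ_T(y_T) = x_c); lane: weak form for the lane's y_T] -/
theorem stripNu_le_inv_of_lt_stripYT (hT : 1 ≤ T) {y : ℝ} (hy : 0 < y) (hlt : y < stripYT T) :
    stripNu T y ≤ hexCriticalFugacity⁻¹ :=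
  stripNu_le_inv_of_mem hT hy fun _ h1 h2 => mem_stripBddSet_of_lt_stripYT_of_le hT hy.le hlt h1 h2

/-- `0 < y_T`. [cite: BeatonBousquetMelouDeGierDuminilCopinGuttmann2014, Corollary 8 (arXiv v5 p. 12: "There exists a unique y_T > 0")] -/
theorem stripYT_pos (hT : 1 ≤ T) : 0 < stripYT T := yStar_pos.trans_le (yStar_le_stripYT hT)

/-- `1 ≤ y* = 1 + √2 ≤ y_T`. [cite: BeatonBousquetMelouDeGierDuminilCopinGuttmann2014, §4.2, eq. (17) (arXiv v5 p. 14: y* ≤ y_T)] -/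
theorem one_le_stripYT (hT : 1 ≤ T) : 1 ≤ stripYT T := by
  refine le_trans ?_ (yStar_le_stripYT hT)
  unfold yStar
  have := Real.sqrt_nonneg 2
  linarith

/-- `ν_T(y) < x_c⁻¹ ⇒ y ≤ y_T` (`y > 0`). [cite: BeatonBousquetMelouDeGierDuminilCopinGuttmann2014, Corollary 8 (arXiv v5 p. 12)] -/
theorem le_stripYT_of_stripNu_lt (hT : 1 ≤ T) {y : ℝ} (hy : 0 < y) (h : stripNu T y < hexCriticalFugacity⁻¹) :
    y ≤ stripYT T :=
  le_stripYT hT hy.le (mem_stripBddSet_of_stripNu_lt hT hy h).2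

/-- `x_c⁻¹ < ν_T(y) ⇒ y_T ≤ y` (`y > 0`). [cite: BeatonBousquetMelouDeGierDuminilCopinGuttmann2014, Corollary 8 (arXiv v5 p. 12)] -/
theorem stripYT_le_of_inv_lt_stripNu (hT : 1 ≤ T) {y : ℝ} (hy : 0 < y) (h : hexCriticalFugacity⁻¹ < stripNu T y) :
    stripYT T ≤ y :=
  le_of_not_gt fun hlt => absurd (stripNu_le_inv_of_lt_stripYT hT hy hlt) (not_le.2 h)

/-- **BBdGDCG14 Corollary 8, the defining clause of `y_T`, for the lane's `y_T` and the top-level growth rate: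
`ν_T(y_T) = x_c⁻¹ = μ_ℍ`**, i.e. "`ρ_T(y_T) = x_c`" with `ρ_T = 1/ν_T` — the two one-sided bounds glued by the modulus of continuity
`ν_T(λy) ≤ λ ν_T(y)`.
[cite: BeatonBousquetMelouDeGierDuminilCopinGuttmann2014, Corollary 8 (arXiv v5 p. 12: "There exists a unique y_T > 0 such that ρ_T(y_T) = x_c := 1/μ"); lane: for the lane's y_T (boundedness threshold of B_{T,L}(x_c; ·)) and the translation-class growth rate ν_T] -/
theorem stripNu_stripYT (hT : 1 ≤ T) : stripNu T (stripYT T) = hexCriticalFugacity⁻¹ := by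
  have hx := hexCriticalFugacity_pos_lt_one.1
  have hX : 0 < hexCriticalFugacity⁻¹ := inv_pos.2 hx
  have ha := stripYT_pos hT
  have hν := stripNu_pos hT ha
  set a := stripYT T with haDef
  set ν := stripNu T a with hνDef
  apply le_antisymm
  · by_contra hgt
    push Not at hgt
    -- `y₁ := a x_c⁻¹ / ν < a`; any `y'` in `(y₁, a)` gives `ν ≤ (a/y') ν(y') ≤ (a/y') x_c⁻¹ < ν`
    set y₁ := a * hexCriticalFugacity⁻¹ / ν with hy₁
    have hy₁a : y₁ < a := by
      rw [hy₁, div_lt_iff₀ hν]; nlinarith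
    set y' := (y₁ + a) / 2 with hy'
    have hy₁0 : 0 < y₁ := by rw [hy₁]; positivity
    have hy'0 : 0 < y' := by rw [hy']; linarith
    have hy'a : y' < a := by rw [hy']; linarith
    have hy₁' : y₁ < y' := by rw [hy']; linarith
    have h1 := stripNu_le_inv_of_lt_stripYT hT hy'0 hy'a
    have hc : 1 ≤ a / y' := (one_le_div hy'0).2 hy'a.le
    have h2 := stripNu_scale_le hT hy'0 hc
    rw [div_mul_cancel₀ _ hy'0.ne'] at h2
    have key : a * hexCriticalFugacity⁻¹ < ν * y' := by
      have := hy₁'; rwa [hy₁, div_lt_iff₀ hν, mul_comm y'] at this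
    have h3 : a / y' * hexCriticalFugacity⁻¹ < ν := by
      rw [div_mul_eq_mul_div, div_lt_iff₀ hy'0]; exact key
    have h4 : a / y' * stripNu T y' ≤ a / y' * hexCriticalFugacity⁻¹ := mul_le_mul_of_nonneg_left h1 (by positivity)
    linarith
  · by_contra hlt
    push Not at hlt
    -- `y₂ := a x_c⁻¹ / ν > a`; any `y` in `(a, y₂)` gives `x_c⁻¹ ≤ ν(y) ≤ (y/a) ν < x_c⁻¹`
    set y₂ := a * hexCriticalFugacity⁻¹ / ν with hy₂
    have hay₂ : a < y₂ := by
      rw [hy₂, lt_div_iff₀ hν]; nlinarith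
    set y := (a + y₂) / 2 with hyDef
    have hay : a < y := by rw [hyDef]; linarith
    have hy0 : 0 < y := ha.trans hay
    have hyy₂ : y < y₂ := by rw [hyDef]; linarith
    have h1 := inv_le_stripNu_of_stripYT_lt hT hy0 hay
    have hc : 1 ≤ y / a := (one_le_div ha).2 hay.le
    have h2 := stripNu_scale_le hT ha hc
    rw [div_mul_cancel₀ _ ha.ne'] at h2
    have key : ν * y < a * hexCriticalFugacity⁻¹ := by
      have := hyy₂; rwa [hy₂, lt_div_iff₀ hν, mul_comm y] at this
    have h3 : y / a * ν < hexCriticalFugacity⁻¹ := by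
      rw [div_mul_eq_mul_div, div_lt_iff₀ ha]; linarith
    linarith

/-- **BBdGDCG14 Corollary 8: the strip thresholds are STRICTLY decreasing, `y_{T+1} < y_T` (`T ≥ 1`), UNCONDITIONALLY** — the
tree had `y_{T+1} ≤ y_T` (`HV.stripYT_succ_le`): at a common value `y₀ = y_T = y_{T+1} ≥ 1` both growth rates would equal
`x_c⁻¹`, contradicting the strict Proposition 7 for the top-level weight (`HV.stripNu_lt_succ`, `HexSAWStripSurfaceGrowthStrict.lean`).
[cite: BeatonBousquetMelouDeGierDuminilCopinGuttmann2014, Corollary 8 (arXiv v5 p. 12; proof pp. 12–13: "since ρ_T(y_T) = x_c and ρ_{T+1}(y) < ρ_T(y) (Proposition 7), we have ρ_{T+1}(y_T) < x_c and thus y_{T+1} < y_T")] -/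
theorem stripYT_succ_lt (hT : 1 ≤ T) : stripYT (T + 1) < stripYT T := by
  refine lt_of_le_of_ne (stripYT_succ_le hT) fun heq => ?_
  have h1 := stripNu_stripYT hT
  have h2 := stripNu_stripYT (T := T + 1) (by omega)
  rw [heq] at h2
  have := stripNu_lt_succ hT (one_le_stripYT hT)
  rw [h1, h2] at this
  exact lt_irrefl _ this

/-- `T ↦ y_{T+1}` is strictly decreasing. [cite: BeatonBousquetMelouDeGierDuminilCopinGuttmann2014, Corollary 8 (arXiv v5 p. 12: "the sequence (y_T) decreases")] -/
theorem strictAnti_stripYT_succ : StrictAnti fun T : ℕ => stripYT (T + 1) :=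
  strictAnti_nat_of_succ_lt fun T => stripYT_succ_lt (T := T + 1) (by omega)

/-- **`y* = 1 + √2 < y_T` STRICTLY for every `T ≥ 1`, UNCONDITIONALLY** (the tree had `y* ≤ y_T`, `HV.yStar_le_stripYT`):
"y_T > y_c for all T" with `y_c = y*` (BBdGDCG14 Theorem 2), at the strip level.
[cite: BeatonBousquetMelouDeGierDuminilCopinGuttmann2014, Corollary 8 with §4.2 (arXiv v5 pp. 12–14: "y_T > y_c for all T", y* ≤ y_{T+1})] -/
theorem yStar_lt_stripYT (hT : 1 ≤ T) : yStar < stripYT T :=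
  (yStar_le_stripYT (T := T + 1) (by omega)).trans_lt (stripYT_succ_lt hT)

/-- Below `y_T`: `ν_T(y) ≤ x_c⁻¹ < ν_{T+1}`-free restatement — for `1 ≤ y < y_T` the next strip's rate already separates:
`ν_T(y) < ν_{T+1}(y)` and `ν_T(y) ≤ x_c⁻¹`. [cite: BeatonBousquetMelouDeGierDuminilCopinGuttmann2014, Proposition 7 and Corollary 8 (arXiv v5 pp. 11–12)] -/
theorem stripNu_lt_succ_of_lt_stripYT (hT : 1 ≤ T) {y : ℝ} (hy : 1 ≤ y) (hlt : y < stripYT T) :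
    stripNu T y < stripNu (T + 1) y ∧ stripNu T y ≤ hexCriticalFugacity⁻¹ :=
  ⟨stripNu_lt_succ hT hy, stripNu_le_inv_of_lt_stripYT hT (zero_lt_one.trans_le hy) hlt⟩

/-! ### An explicit rate of strict decrease -/

/-- `1 < y* ≤ y_T`. [cite: BeatonBousquetMelouDeGierDuminilCopinGuttmann2014, §4.2, eq. (17) (arXiv v5 p. 14: y* ≤ y_T, y* = 1 + √2)] -/
theorem one_lt_stripYT (hT : 1 ≤ T) : 1 < stripYT T := by
  refine lt_of_lt_of_le ?_ (yStar_le_stripYT hT)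
  unfold yStar
  have : 0 < Real.sqrt 2 := by positivity
  linarith

/-- `ν_T(1) ≤ x_c⁻¹` — the unweighted strip is sub-critical for the threshold count (`1 < y_T`). [cite: BeatonBousquetMelouDeGierDuminilCopinGuttmann2014, Corollary 8 (arXiv v5 p. 12: ρ_T(1) > x_c)] -/
theorem stripNu_one_le_inv (hT : 1 ≤ T) : stripNu T 1 ≤ hexCriticalFugacity⁻¹ :=
  stripNu_le_inv_of_lt_stripYT hT one_pos (one_lt_stripYT hT)

/-- `ν_T(y) ≤ y · x_c⁻¹` for `y ≥ 1` (scaling from `y = 1`). [cite: BeatonBousquetMelouDeGierDuminilCopinGuttmann2014, Proposition 6 (arXiv v5 p. 10)] -/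
theorem stripNu_le_mul_inv (hT : 1 ≤ T) {y : ℝ} (hy : 1 ≤ y) : stripNu T y ≤ y * hexCriticalFugacity⁻¹ := by
  have h := stripNu_scale_le hT one_pos hy
  rw [mul_one] at h
  exact h.trans (mul_le_mul_of_nonneg_left (stripNu_one_le_inv hT) (by linarith))

/-- **An explicit rate for `y_{T+1} < y_T` (not in print)**:
`log y_{T+1} + log(1 + (y_T x_c⁻¹)^{-(4T+4)}) / (2T) ≤ log y_T` (`T ≥ 1`), i.e.
`y_T / y_{T+1} ≥ (1 + (y_T/x_c)^{-(4T+4)})^{1/(2T)}` with `y_T ≤ y_1 = 2 + √2` — from the margin of `HV.log_stripNu_succ_sub_log_ge` at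
`y = y_T`, the identifications `ν_T(y_T) = ν_{T+1}(y_{T+1}) = x_c⁻¹` and the scaling modulus `ν_{T+1}(y_T) ≤ (y_T/y_{T+1}) ν_{T+1}(y_{T+1})`.
[cite: BeatonBousquetMelouDeGierDuminilCopinGuttmann2014, Corollary 8 (arXiv v5 p. 12: y_{T+1} < y_T; printed without a rate — the explicit gap is the lane's)] -/
theorem log_stripYT_succ_add_le (hT : 1 ≤ T) :
    Real.log (stripYT (T + 1)) + Real.log (1 + (stripYT T * hexCriticalFugacity⁻¹) ^ (-(4 * (T : ℝ) + 4))) / (2 * (T : ℝ)) ≤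
      Real.log (stripYT T) := by
  have hx := hexCriticalFugacity_pos_lt_one.1
  have hX : 0 < hexCriticalFugacity⁻¹ := inv_pos.2 hx
  have hT1 : 1 ≤ T + 1 := by omega
  have ha := stripYT_pos hT
  have hb := stripYT_pos hT1
  have ha1 := one_le_stripYT hT
  have hab : stripYT (T + 1) ≤ stripYT T := stripYT_succ_le hT
  have hT0 : (0 : ℝ) < 2 * (T : ℝ) := by
    have : (1 : ℝ) ≤ T := by exact_mod_cast hT
    linarith
  have hνa : 0 < stripNu (T + 1) (stripYT T) := stripNu_pos hT1 ha
  -- the margin at `y = y_T`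
  have hm := log_stripNu_succ_sub_log_ge hT ha1
  rw [stripNu_stripYT hT] at hm
  -- scaling: `ν_{T+1}(y_T) ≤ (y_T/y_{T+1}) ν_{T+1}(y_{T+1}) = (y_T/y_{T+1}) x_c⁻¹`
  have hc : 1 ≤ stripYT T / stripYT (T + 1) := (one_le_div hb).2 hab
  have hs := stripNu_scale_le hT1 hb hc
  rw [div_mul_cancel₀ _ hb.ne', stripNu_stripYT hT1] at hs
  have hlog : Real.log (stripNu (T + 1) (stripYT T)) ≤
      Real.log (stripYT T) - Real.log (stripYT (T + 1)) + Real.log hexCriticalFugacity⁻¹ := by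
    have := Real.log_le_log hνa hs
    rwa [Real.log_mul (div_pos ha hb).ne' hX.ne', Real.log_div ha.ne' hb.ne'] at this
  -- the margin is at least the explicit one: `ν_{T+1}(y_T) ≤ y_T x_c⁻¹`
  have hνle : stripNu (T + 1) (stripYT T) ≤ stripYT T * hexCriticalFugacity⁻¹ := stripNu_le_mul_inv hT1 ha1
  have hexp : (stripYT T * hexCriticalFugacity⁻¹) ^ (-(4 * (T : ℝ) + 4)) ≤ stripNu (T + 1) (stripYT T) ^ (-(4 * (T : ℝ) + 4)) :=
    Real.rpow_le_rpow_of_nonpos hνa hνle (by have : (0 : ℝ) ≤ T := Nat.cast_nonneg T; linarith)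
  have hm' : Real.log (1 + (stripYT T * hexCriticalFugacity⁻¹) ^ (-(4 * (T : ℝ) + 4))) / (2 * (T : ℝ)) ≤
      Real.log (1 + stripNu (T + 1) (stripYT T) ^ (-(4 * (T : ℝ) + 4))) / (2 * (T : ℝ)) :=
    div_le_div_of_nonneg_right (Real.log_le_log (by positivity) (by linarith)) hT0.le
  linarith

/-- The same gap exponentiated: `y_{T+1} · (1 + (y_T x_c⁻¹)^{-(4T+4)})^{1/(2T)} ≤ y_T` (`T ≥ 1`).
[cite: BeatonBousquetMelouDeGierDuminilCopinGuttmann2014, Corollary 8 (arXiv v5 p. 12: y_{T+1} < y_T; the explicit gap is the lane's)] -/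
theorem stripYT_succ_mul_le (hT : 1 ≤ T) :
    stripYT (T + 1) * (1 + (stripYT T * hexCriticalFugacity⁻¹) ^ (-(4 * (T : ℝ) + 4))) ^ (1 / (2 * (T : ℝ))) ≤ stripYT T := by
  have hx := hexCriticalFugacity_pos_lt_one.1
  have ha := stripYT_pos hT
  have hb := stripYT_pos (T := T + 1) (by omega)
  have hq : 0 < 1 + (stripYT T * hexCriticalFugacity⁻¹) ^ (-(4 * (T : ℝ) + 4)) := by positivity
  have h := log_stripYT_succ_add_le hT
  have e : Real.log (stripYT (T + 1) * (1 + (stripYT T * hexCriticalFugacity⁻¹) ^ (-(4 * (T : ℝ) + 4))) ^ (1 / (2 * (T : ℝ)))) =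
      Real.log (stripYT (T + 1)) + Real.log (1 + (stripYT T * hexCriticalFugacity⁻¹) ^ (-(4 * (T : ℝ) + 4))) / (2 * (T : ℝ)) := by
    rw [Real.log_mul hb.ne' (Real.rpow_pos_of_pos hq _).ne', Real.log_rpow hq]; ring
  rw [← Real.log_le_log_iff (mul_pos hb (Real.rpow_pos_of_pos hq _)) ha, e]
  exact h

end Threshold

end Literature.Probability.RandomPlanarGeometry.SAW.HV

/-! ## PART 2 — E «LIMITS-FULL» ed.3 78d902ae831f5f4d (a-p2 g10/g11) (verbatim) -/

/-!
# BBdGDCG14 Proposition 9 on its printed range `0 < y < y_T`, and the arches at the critical fugacity: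
# `A_T(x_c; 1 + √2) = 1/cos(3π/8)` for every `T`

Topic `Literature/Probability/RandomPlanarGeometry` (continues `HexSAWStripSurfaceLimits.lean` — `HV.stripAyLim`, `HV.stripByLim`,
`HV.strip_identity_limY` (eq. (18) given `E → 0`), `HV.strip_identity_limY_of_lt_yStar` (eq. (18) on `0 < y < y*`) —,
`HexSAWStripSurfaceThresholdClasses.lean` (`HV.bddAbove_stripGFy_alpha_of_lt_stripYT`), the face `HV.stripELimZeroY_holds`
(`HexSAWStripELimZeroY.lean`) and `HexSAWStripSurfaceThresholdRate.lean` (`HV.mem_stripBddSet_of_lt_stripYT_of_le`,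
`HV.yStar_lt_stripYT : y* < y_T`)).  Source: N. R. Beaton, M. Bousquet-Mélou, J. de Gier, H. Duminil-Copin, A. J. Guttmann, *The
critical fugacity for surface adsorption of self-avoiding walks on the honeycomb lattice is `1 + √2`*, Comm. Math. Phys. 326 (2014)
727–754, arXiv:1109.0358v5, Proposition 9 (p. 14): "For `0 ≤ y < y_T` (the radius of convergence of `A_T(x_c, ·)` and `B_T(x_c, ·)`),
the series counting arches and bridges in a `T`-strip satisfy `α A_T(x_c,y) + β(y) B_T(x_c,y) = 1`", and §4.2 (p. 14): "Let us fix
`T`, and set `y = y*` in (16). Since `β(y*) = 0`, we obtain: `1 = α A_{T,L}(x_c; y*) + ε E_{T,L}(x_c; y*)`".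

## What is proved (namespace `Literature.Probability.RandomPlanarGeometry.SAW.HV`; `T ≥ 1`; standard axioms)

The tree had eq. (18) on the sub-range `0 < y < y* = 1 + √2` (where every coefficient of (16) is non-negative).  With the strict
inequality `y* < y_T` (`HexSAWStripSurfaceThresholdRate.lean`) the printed range is reached:
* `tendsto_stripBy_of_lt_stripYT`, `tendsto_stripAy_of_lt_stripYT` — the limits `B_T(x_c;y)`, `A_T(x_c;y)` exist on `0 < y < y_T`;
  `tendsto_stripGFy_eps_of_lt_stripYT` — `E_{T,L}(x_c;y) → 0` there;
* **`strip_identity_limY_of_lt_stripYT`** — Proposition 9, eq. (18), on the PRINTED range `0 < y < y_T`: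
  `cos(3π/8) A_T(x_c,y) + β(y) B_T(x_c,y) = 1`;
* ★ **`stripAyLim_yStar : stripAyLim T yStar = 1 / cos(3π/8)`** for EVERY `T ≥ 1`, with NO side hypothesis — at the critical
  surface fugacity `y* = 1 + √2` (`β(y*) = 0`) the arch generating function of every strip has the same value
  `1/cos(3π/8) = 2/√(2−√2)`.  This value is PRINTED: Beaton–Guttmann–Jensen, J. Phys. A 45 (2012) 055208 = arXiv:1110.6695, §2
  eq. (4) "`1 = cos(3π/8) A_T(x_c, y_c)`" ("a remarkable equation in that it implies that `y_c` can be identified from the generating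
  function `A_T(x_c, y)` for any width `T`").  The tree's `HexSAWStripSurfaceCriticalArch.lean` has the conditional form
  `HV.stripAyLim_yStar_eq (h : yStar < stripYT T)`; the present theorem is its discharge by `HV.yStar_lt_stripYT`
  (`HexSAWStripSurfaceThresholdRate.lean`), proved here directly from `strip_identity_limY_of_lt_stripYT`;
  `bddAbove_stripGFy_beta_yStar` — the bridges stay bounded at `y*` (`y* < y_T`); `tendsto_stripGFy_alpha_yStar` — the finite-`L` form.

Label: CONSOLIDATION (Proposition 9 on its printed range; `A_T(x_c; y*) = 1/cos(3π/8)` = BGJ12-Ads eq. (4) AS PRINTED, here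
unconditional for the lane's `y_T` because `y* < y_T` gives `E_{T,L}(x_c; y*) → 0`).  `β(y*) = 0` is the tree's `HV.betaY_yStar`
(`HexSAWStripSurfaceBridgeSqueeze.lean`); it is used inline, not restated.  Lane «pcv-sawmu», a-p2 g10 (ed.3 a-p2 g11: the duplicate
`betaY_yStar` dropped, `mem_stripBddSet_of_lt_stripYT_of_le` renamed with `HexSAWStripSurfaceThresholdRate.lean`, labels as ruled).
-/

noncomputable section

open Finset Filter Topology

namespace Literature.Probability.RandomPlanarGeometry.SAW.HV

variable {T : ℕ}

/-- `B_{T,L}(x_c,y) → B_T(x_c,y)` as `L → ∞` on the printed range `0 ≤ y < y_T` (bounded monotone).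
[cite: BeatonBousquetMelouDeGierDuminilCopinGuttmann2014, Proposition 9 (arXiv v5 p. 14: 0 ≤ y < y_T, the radius of B_T(x_c, ·))] -/
theorem tendsto_stripBy_of_lt_stripYT (hT : 1 ≤ T) {y : ℝ} (hy : 0 ≤ y) (hlt : y < stripYT T) :
    Tendsto (fun L : ℕ => stripGFy T L (IsBetaDart T) y) atTop (𝓝 (stripByLim T y)) :=
  tendsto_atTop_ciSup (fun _ _ h => stripGFy_beta_mono_L h hy) (mem_stripBddSet_of_lt_stripYT_of_le hT hy hlt hT le_rfl).2

/-- `A_{T,L}(x_c,y) → A_T(x_c,y)` as `L → ∞` on the printed range `0 ≤ y < y_T`.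
[cite: BeatonBousquetMelouDeGierDuminilCopinGuttmann2014, Proposition 9 (arXiv v5 p. 14: 0 ≤ y < y_T, the radius of A_T(x_c, ·))] -/
theorem tendsto_stripAy_of_lt_stripYT (hT : 1 ≤ T) {y : ℝ} (hy : 0 ≤ y) (hlt : y < stripYT T) :
    Tendsto (fun L : ℕ => stripGFy T L IsAlphaDart y) atTop (𝓝 (stripAyLim T y)) :=
  tendsto_atTop_ciSup (fun _ _ h => stripGFy_alpha_mono_L h hy) (bddAbove_stripGFy_alpha_of_lt_stripYT hT hy hlt)

/-- `E_{T,L}(x_c,y) → 0` on `0 < y < y_T` (the bridges are bounded there; face Y3′). [cite: BeatonBousquetMelouDeGierDuminilCopinGuttmann2014, proof of Proposition 9 (arXiv v5 p. 14: "lim_L E_{T,L}(x_c; y) = 0 for 0 ≤ y < y_T")] -/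
theorem tendsto_stripGFy_eps_of_lt_stripYT (hT : 1 ≤ T) {y : ℝ} (hy : 0 < y) (hlt : y < stripYT T) :
    Tendsto (fun L : ℕ => stripGFy T L (IsEpsDart L) y) atTop (𝓝 0) := by
  obtain ⟨K, hK⟩ := (mem_stripBddSet_of_lt_stripYT_of_le hT hy.le hlt hT le_rfl).2
  exact stripELimZeroY_holds T y K hT hy fun L => hK ⟨L, rfl⟩

/-- **BBdGDCG Proposition 9, eq. (18), on the printed range `0 < y < y_T`**: `cos(3π/8) A_T(x_c,y) + β(y) B_T(x_c,y) = 1`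
(for `y* ≤ y < y_T` the coefficient `β(y)` is `≤ 0`). [cite: BeatonBousquetMelouDeGierDuminilCopinGuttmann2014, Proposition 9, eq. (18) (arXiv v5 p. 14)] -/
theorem strip_identity_limY_of_lt_stripYT (hT : 1 ≤ T) {y : ℝ} (hy : 0 < y) (hlt : y < stripYT T) :
    Real.cos (3 * Real.pi / 8) * stripAyLim T y + betaY y * stripByLim T y = 1 := by
  have hlim : Tendsto (fun L : ℕ => Real.cos (3 * Real.pi / 8) * stripGFy T L IsAlphaDart y +
      Real.cos (Real.pi / 4) * stripGFy T L (IsEpsDart L) y + betaY y * stripGFy T L (IsBetaDart T) y) atTop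
      (𝓝 (Real.cos (3 * Real.pi / 8) * stripAyLim T y + Real.cos (Real.pi / 4) * 0 + betaY y * stripByLim T y)) :=
    (((tendsto_stripAy_of_lt_stripYT hT hy.le hlt).const_mul _).add
      ((tendsto_stripGFy_eps_of_lt_stripYT hT hy hlt).const_mul _)).add ((tendsto_stripBy_of_lt_stripYT hT hy.le hlt).const_mul _)
  have hconst : (fun L : ℕ => Real.cos (3 * Real.pi / 8) * stripGFy T L IsAlphaDart y +
      Real.cos (Real.pi / 4) * stripGFy T L (IsEpsDart L) y + betaY y * stripGFy T L (IsBetaDart T) y) = fun _ => 1 :=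
    funext fun L => stripIdentityY_holds T L y hT hy
  rw [hconst] at hlim
  have h := tendsto_nhds_unique tendsto_const_nhds hlim
  linarith

/-- At the critical surface fugacity the bridges of every strip stay bounded: `y* ∈ stripBddSet T` (because `y* < y_T`).
[cite: BeatonBousquetMelouDeGierDuminilCopinGuttmann2014, Corollary 8 with Theorem 2 (arXiv v5 pp. 12, 3: y_T > y_c = 1 + √2)] -/
theorem bddAbove_stripGFy_beta_yStar (hT : 1 ≤ T) : BddAbove (Set.range fun L : ℕ => stripGFy T L (IsBetaDart T) yStar) :=
  (mem_stripBddSet_of_lt_stripYT_of_le hT yStar_pos.le (yStar_lt_stripYT hT) hT le_rfl).2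

/-- ★ **The arches at the critical surface fugacity: `A_T(x_c; 1 + √2) = 1/cos(3π/8)` for every `T ≥ 1`, unconditionally** — the
`L → ∞` limit of the printed display "`1 = α A_{T,L}(x_c; y*) + ε E_{T,L}(x_c; y*)`", the side term vanishing because `y* < y_T`
(`HV.yStar_lt_stripYT`); discharges the hypothesis of the tree's `HV.stripAyLim_yStar_eq`.
[cite: BeatonGuttmannJensen2012Adsorption, §2 eq. (4) (arXiv:1110.6695 p. 4: "1 = cos(3π/8) A_T(x_c, y_c)"); BeatonBousquetMelouDeGierDuminilCopinGuttmann2014, §4.2 (arXiv v5 p. 14: "1 = α A_{T,L}(x_c; y*) + ε E_{T,L}(x_c; y*)") with Proposition 9 (p. 14) and Corollary 8 (proof p. 13: "y_T > y_c for all T")] -/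
theorem stripAyLim_yStar (hT : 1 ≤ T) : stripAyLim T yStar = 1 / Real.cos (3 * Real.pi / 8) := by
  have h := strip_identity_limY_of_lt_stripYT hT yStar_pos (yStar_lt_stripYT hT)
  have hb : betaY yStar = 0 := by unfold betaY yStar; simp  -- = tree `HV.betaY_yStar` (HexSAWStripSurfaceBridgeSqueeze)
  rw [hb, zero_mul, add_zero] at h
  have hc : 0 < Real.cos (3 * Real.pi / 8) := cos_three_pi_div_eight_pos
  field_simp
  linarith

/-- The finite-strip form: `A_{T,L}(x_c; 1 + √2) → 1/cos(3π/8)` as `L → ∞`, for every `T ≥ 1`.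
[cite: BeatonBousquetMelouDeGierDuminilCopinGuttmann2014, §4.2 (arXiv v5 p. 14)] -/
theorem tendsto_stripGFy_alpha_yStar (hT : 1 ≤ T) :
    Tendsto (fun L : ℕ => stripGFy T L IsAlphaDart yStar) atTop (𝓝 (1 / Real.cos (3 * Real.pi / 8))) := by
  rw [← stripAyLim_yStar hT]
  exact tendsto_stripAy_of_lt_stripYT hT yStar_pos.le (yStar_lt_stripYT hT)

end Literature.Probability.RandomPlanarGeometry.SAW.HV

/-! ## PART 3 — F «THRESHOLD-DIVERGENCE» ed.4 9f615a4909d14a9d (a-p2 g11) (verbatim) -/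

/-!
# Divergence AT the threshold: `B_T(x_c; y_T) = A_T(x_c; y_T) = +∞`, and the boundedness set is exactly `[0, y_T)`
# (BBdGDCG14 Corollary 8 — the radius clause completed at the radius itself)

Topic `Literature/Probability/RandomPlanarGeometry` (continues `HexSAWStripSurfaceThresholdRate.lean` — `HV.stripNu_stripYT :
ν_T(y_T) = x_c⁻¹`, `HV.yStar_lt_stripYT : y* < y_T`, `HV.mem_stripBddSet_of_lt_stripYT_of_le`, `HV.stripBddSet_add_subset` —,
`HexSAWStripSurfaceGrowthBounds.lean` (`HV.sum_pow_mul_stripZL_le`: the finite Hammersley–Welsh-type decomposition inside the strip gives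
a UNIFORM bound on `Σ_{n ≤ N} x_cⁿ Z_n(y)` when all bridge classes `B_h(x_c; y)`, `h ≤ T`, are bounded), `HexSAWStripSurfaceGrowth.lean`
(`HV.pow_stripNu_le : ν_T(y)ⁿ ≤ max(1,y⁻¹) Z_n(y)`, Fekete's infimum form), `HexSAWStripSurfaceArchRadius.lean`
(`HV.mem_stripBddSet_of_bddAbove_alpha`: bounded arches ⇒ bounded bridges away from `y*`) and `HexSAWStripSurfaceRadius.lean`
(`HV.stripBcoeff`, `HV.stripBddSet_eq_summable`, `HV.not_summable_stripBcoeff`).  Source: N. R. Beaton, M. Bousquet-Mélou, J. de Gier,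
H. Duminil-Copin, A. J. Guttmann, *The critical fugacity for surface adsorption of self-avoiding walks on the honeycomb lattice is
`1 + √2`*, Comm. Math. Phys. 326 (2014) 727–754, arXiv:1109.0358v5, §3.2, Corollary 8 (p. 12): "There exists a unique `y_T > 0` such
that `ρ_T(y_T) = x_c := 1/μ`. The series (in `y`) `A_T(x_c, y)`, `B_T(x_c, y)` and `C_T(x_c, y)` have radius of convergence `y_T`";
proof (p. 13): "By definition of `ρ_T`, the series `C_T(x_c, y)` converges if `x_c < ρ_T(y)`, and diverges if `x_c > ρ_T(y)`";
`C_T(x_c, ·)` is a series in `y` with nonnegative coefficients (p. 13: "We must first explain why `C_T(x_c, y)` is indeed a series in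
`y` …") (rationality: proof of Proposition 7, arXiv v5 p. 12: "a rational function of `x` and `y`").

In print the three series are rational in `y` with nonnegative coefficients, so they DIVERGE AT their radius `y_T` (a pole on the
positive axis).  In the tree, `y_T := sup {y ≥ 0 : L ↦ B_{T,L}(x_c; y) bounded}` (`HV.stripYT`) and no rationality is available; what
happens AT `y = y_T` was open (`HexSAWStripSurfaceRadius.lean` has convergence for `y < y_T` and divergence for `y > y_T` only).
This file settles it by growth rates: `ν_T(y_T) = x_c⁻¹` (`HexSAWStripSurfaceThresholdRate.lean`), hence by Fekete's infimum form
`x_cⁿ Z_n(y_T) ≥ 1/max(1, y_T⁻¹)` for EVERY `n`, so `Σ_n x_cⁿ Z_n(y_T) = ∞`; were all bridge classes `B_h(x_c; y_T)`, `h ≤ T`, bounded,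
the finite bridge decomposition inside the strip would bound these partial sums uniformly — contradiction; and the boundedness sets
are nested in `h`, so it is `B_T(x_c; y_T)` itself that is unbounded.  The arches follow from `HexSAWStripSurfaceArchRadius.lean`
(`y_T > y*`).

## Main statements (namespace `Literature.Probability.RandomPlanarGeometry.SAW.HV`; `T ≥ 1`; standard axioms)

* `succ_le_mul_sum_pow_mul_stripZL` — if `x_c⁻¹ ≤ ν_T(y)` then `N + 1 ≤ max(1,y⁻¹) · Σ_{n ≤ N} x_cⁿ Z_n(y)` for every `N`;
  `not_mem_stripBddSet_of_inv_le_stripNu` — then `y ∉ stripBddSet T`;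
* ★ **`stripYT_not_mem_stripBddSet`** — `y_T ∉ stripBddSet T`: **`not_bddAbove_stripGFy_beta_stripYT`**,
  **`tendsto_stripGFy_beta_stripYT_atTop`** — `B_{T,L}(x_c; y_T) → +∞` as `L → ∞`;
* ★ **`stripBddSet_eq_Ico`** — `stripBddSet T = [0, y_T)` exactly; `mem_stripBddSet_iff`; `bddAbove_stripGFy_beta_iff_lt_stripYT`;
* ★ **`not_bddAbove_stripGFy_alpha_stripYT`**, **`tendsto_stripGFy_alpha_stripYT_atTop`** — `A_{T,L}(x_c; y_T) → +∞`;
  **`bddAbove_stripGFy_alpha_iff_lt_stripYT`** (`0 ≤ y`): the arch class is bounded iff `y < y_T` — the common radius of `A_T(x_c;·)`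
  and `B_T(x_c;·)` with the behaviour AT the radius, no exceptional point; `mem_stripBddSet_iff_bddAbove_alpha'` (the `y ≠ y*`
  proviso of `HexSAWStripSurfaceArchRadius.lean` removed by `y* < y_T`);
* **`summable_stripBcoeff_iff_lt_stripYT`**, **`not_summable_stripBcoeff_stripYT`** — the series `B_T(x_c; y) = Σ_m β_{T,m} y^m`
  converges iff `y < y_T` (`0 ≤ y`); it DIVERGES AT its radius;
* **`summable_pow_mul_stripZL_iff_lt_stripYT`**, **`not_summable_pow_mul_stripZL_stripYT`** — the strip generating function of all
  walks `Σ_n x_c^{n+1} Z_n(y)` converges iff `y < y_T` (`y > 0`) — the printed "`C_T(x_c, y)` converges if `x_c < ρ_T(y)`, and diverges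
  if `x_c > ρ_T(y)`" for the lane's translation classes, INCLUDING the boundary case `x_c = ρ_T(y_T)`.
* `stripYT_eq_sSup_alpha` — `y_T = sup {y ≥ 0 : L ↦ A_{T,L}(x_c; y) bounded}`: the lane's `y_T` IS the radius of the arch series
  (the printed sentence for `A_T`, literally); `eventually_not_bddAbove_stripGFy_alpha_of_yStar_lt`, `…beta…` — for every
  `y > y* = 1 + √2` the arch and bridge classes of all sufficiently wide strips are unbounded (`y_{T} ↓ y*`): the strip-level
  signature of the adsorbed phase.
* ★ **`tendsto_stripByLim_nhdsLT_stripYT`**, **`tendsto_stripAyLim_nhdsLT_stripYT`** — the limit series blow up at the radius in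
  the fugacity variable: `B_T(x_c; y) → +∞` and `A_T(x_c; y) → +∞` as `y ↑ y_T` (Pringsheim-type behaviour of the printed rational
  series at their positive pole, here from the divergence of the finite-strip polynomials AT `y_T` and their continuity in `y`).

Label: CONSOLIDATION BY A DIFFERENT PROOF of a printed clause (Cor. 8: the series have radius `y_T` — here with the divergence AT
`y_T` that print gets from rationality), via Fekete's infimum inequality and the finite bridge decomposition instead of rationality.
Lane «pcv-sawmu», a-p2 g11, 2026-08-23 (ed.4: lit-1 g16 tokens TD1–TD3, docstring-only).
-/

noncomputable section

open Finset Filter Topology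

namespace Literature.Probability.RandomPlanarGeometry.SAW.HV

variable {T : ℕ}

/-! ### At growth rate `x_c⁻¹` the partial sums grow at least linearly -/

/-- **Fekete's infimum form at the critical rate**: if `x_c⁻¹ ≤ ν_T(y)` (`y > 0`) then `N + 1 ≤ max(1, y⁻¹) · Σ_{n ≤ N} x_cⁿ Z_n(y)` for
every `N` (each term is `≥ 1` after the factor `max(1,y⁻¹)`, because `ν_T(y)ⁿ ≤ max(1,y⁻¹) Z_n(y)` and `x_c ν_T(y) ≥ 1`).
[cite: BeatonBousquetMelouDeGierDuminilCopinGuttmann2014, Proposition 6 and its proof (arXiv v5 pp. 10–11: "the existence of the limits follows from concatenation and unfolding arguments as given in Section 4 of [16]"); Corollary 8 (p. 12)] -/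
theorem succ_le_mul_sum_pow_mul_stripZL (hT : 1 ≤ T) {y : ℝ} (hy : 0 < y) (hν : hexCriticalFugacity⁻¹ ≤ stripNu T y) (N : ℕ) :
    (N : ℝ) + 1 ≤ HexBW.yK y * ∑ n ∈ range (N + 1), hexCriticalFugacity ^ n * stripZL T n y := by
  obtain ⟨hx0, -⟩ := hexCriticalFugacity_pos_lt_one
  have hν0 : 0 ≤ stripNu T y := (stripNu_pos hT hy).le
  have hxν : 1 ≤ hexCriticalFugacity * stripNu T y := by
    calc (1 : ℝ) = hexCriticalFugacity * hexCriticalFugacity⁻¹ := (mul_inv_cancel₀ hx0.ne').symm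
      _ ≤ hexCriticalFugacity * stripNu T y := mul_le_mul_of_nonneg_left hν hx0.le
  have hterm : ∀ n : ℕ, (1 : ℝ) ≤ HexBW.yK y * (hexCriticalFugacity ^ n * stripZL T n y) := fun n =>
    calc (1 : ℝ) ≤ (hexCriticalFugacity * stripNu T y) ^ n := one_le_pow₀ hxν
      _ = hexCriticalFugacity ^ n * stripNu T y ^ n := mul_pow _ _ _
      _ ≤ hexCriticalFugacity ^ n * (HexBW.yK y * stripZL T n y) :=
          mul_le_mul_of_nonneg_left (pow_stripNu_le hT n hy hν0) (pow_nonneg hx0.le _)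
      _ = HexBW.yK y * (hexCriticalFugacity ^ n * stripZL T n y) := by ring
  calc (N : ℝ) + 1 = ∑ _n ∈ range (N + 1), (1 : ℝ) := by simp
    _ ≤ ∑ n ∈ range (N + 1), HexBW.yK y * (hexCriticalFugacity ^ n * stripZL T n y) := sum_le_sum fun n _ => hterm n
    _ = HexBW.yK y * ∑ n ∈ range (N + 1), hexCriticalFugacity ^ n * stripZL T n y := by rw [mul_sum]

/-- **At growth rate `x_c⁻¹` some bridge class `B_h(x_c; y)`, `h ≤ T`, is unbounded** — else the finite bridge decomposition inside the
strip (`sum_pow_mul_stripZL_le`) bounds the partial sums uniformly, against their linear growth.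
[cite: BeatonBousquetMelouDeGierDuminilCopinGuttmann2014, proof of Corollary 8, (15) (arXiv v5 p. 13: "ρ_T(y) > ρ_T(y_T) ⟺ y < y_T"); DuminilCopinSmirnov2012, §3 (the bridge decomposition bound)] -/
theorem exists_not_mem_stripBddSet_of_inv_le_stripNu (hT : 1 ≤ T) {y : ℝ} (hy : 0 < y) (hν : hexCriticalFugacity⁻¹ ≤ stripNu T y) :
    ∃ h, 1 ≤ h ∧ h ≤ T ∧ y ∉ stripBddSet h := by
  by_contra hall
  push Not at hall
  -- a common bound for all the classes `h ≤ T`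
  have hb : ∀ h ∈ Finset.Icc 1 T, BddAbove (Set.range fun L : ℕ => stripGFy h L (IsBetaDart h) y) := fun h hh =>
    (hall h (Finset.mem_Icc.1 hh).1 (Finset.mem_Icc.1 hh).2).2
  set K := ∑ h ∈ Finset.Icc 1 T, ⨆ L : ℕ, stripGFy h L (IsBetaDart h) y with hK
  have hKh : ∀ h ∈ Finset.Icc 1 T, 0 ≤ ⨆ L : ℕ, stripGFy h L (IsBetaDart h) y := fun h hh =>
    le_ciSup_of_le (hb h hh) 0 (stripGFy_nonneg' h 0 _ hy.le)
  have hK0 : 0 ≤ K := sum_nonneg hKh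
  have hKb : ∀ h, 1 ≤ h → h ≤ T → ∀ L, stripGFy h L (IsBetaDart h) y ≤ K := by
    intro h h1 h2 L
    have hh : h ∈ Finset.Icc 1 T := Finset.mem_Icc.2 ⟨h1, h2⟩
    exact (le_ciSup (hb h hh) L).trans (single_le_sum (f := fun h => ⨆ L : ℕ, stripGFy h L (IsBetaDart h) y) hKh hh)
  set C := HexBW.yK y * (2 * T * G0 T * (1 + 2 * T * ((hexCriticalFugacity⁻¹ + hexCriticalFugacity⁻¹ ^ 2) * K))) ^ 2
  have hKy : 0 ≤ HexBW.yK y := by linarith [HexBW.one_le_yK y]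
  -- linear growth against the uniform bound
  obtain ⟨N, hN⟩ := exists_nat_gt (HexBW.yK y * C)
  have h1 := succ_le_mul_sum_pow_mul_stripZL hT hy hν N
  have h2 := mul_le_mul_of_nonneg_left (sum_pow_mul_stripZL_le hT hy hK0 hKb N) hKy
  linarith

/-- **At growth rate `x_c⁻¹` the top class itself is unbounded**: `x_c⁻¹ ≤ ν_T(y) ⇒ y ∉ stripBddSet T` (the boundedness sets are nested,
`stripBddSet T ⊆ stripBddSet h` for `h ≤ T`). [cite: BeatonBousquetMelouDeGierDuminilCopinGuttmann2014, Corollary 8 (arXiv v5 p. 12)] -/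
theorem not_mem_stripBddSet_of_inv_le_stripNu (hT : 1 ≤ T) {y : ℝ} (hy : 0 < y) (hν : hexCriticalFugacity⁻¹ ≤ stripNu T y) :
    y ∉ stripBddSet T := by
  intro hmem
  obtain ⟨h, h1, h2, hno⟩ := exists_not_mem_stripBddSet_of_inv_le_stripNu hT hy hν
  obtain ⟨d, rfl⟩ := Nat.exists_eq_add_of_le h2
  exact hno (stripBddSet_add_subset h1 d hmem)

/-! ### Divergence of the bridges AT `y_T` -/

/-- ★ **`y_T ∉ stripBddSet T`** (`T ≥ 1`): the supremum defining `y_T` is NOT attained — because `ν_T(y_T) = x_c⁻¹`.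
[cite: BeatonBousquetMelouDeGierDuminilCopinGuttmann2014, Corollary 8 (arXiv v5 p. 12: "ρ_T(y_T) = x_c"; the series have radius y_T and, being rational with nonnegative coefficients, diverge there); lane: by growth rates, no rationality] -/
theorem stripYT_not_mem_stripBddSet (hT : 1 ≤ T) : stripYT T ∉ stripBddSet T :=
  not_mem_stripBddSet_of_inv_le_stripNu hT (stripYT_pos hT) (stripNu_stripYT hT).ge

/-- ★ **`B_{T,L}(x_c; y_T)` is unbounded in `L`.** [cite: BeatonBousquetMelouDeGierDuminilCopinGuttmann2014, Corollary 8 (arXiv v5 p. 12: B_T(x_c; ·) has radius y_T)] -/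
theorem not_bddAbove_stripGFy_beta_stripYT (hT : 1 ≤ T) :
    ¬ BddAbove (Set.range fun L : ℕ => stripGFy T L (IsBetaDart T) (stripYT T)) := fun hb =>
  stripYT_not_mem_stripBddSet hT ⟨(stripYT_pos hT).le, hb⟩

/-- ★ **`B_{T,L}(x_c; y_T) → +∞` as `L → ∞`** (monotone and unbounded): the bridge series diverges AT its radius.
[cite: BeatonBousquetMelouDeGierDuminilCopinGuttmann2014, Corollary 8 (arXiv v5 p. 12)] -/
theorem tendsto_stripGFy_beta_stripYT_atTop (hT : 1 ≤ T) :
    Tendsto (fun L : ℕ => stripGFy T L (IsBetaDart T) (stripYT T)) atTop atTop := by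
  refine tendsto_atTop_atTop_of_monotone (fun L L' hLL' => stripGFy_beta_mono_L hLL' (stripYT_pos hT).le) fun b => ?_
  by_contra hb
  push Not at hb
  exact not_bddAbove_stripGFy_beta_stripYT hT ⟨b, by rintro _ ⟨L, rfl⟩; exact (hb L).le⟩

/-- **The boundedness set, exactly**: `y ∈ stripBddSet T ↔ 0 ≤ y < y_T` (`T ≥ 1`).
[cite: BeatonBousquetMelouDeGierDuminilCopinGuttmann2014, Corollary 8 (arXiv v5 p. 12)] -/
theorem mem_stripBddSet_iff (hT : 1 ≤ T) {y : ℝ} : y ∈ stripBddSet T ↔ 0 ≤ y ∧ y < stripYT T := by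
  constructor
  · intro h
    refine ⟨h.1, lt_of_le_of_ne (le_stripYT hT h.1 h.2) fun heq => ?_⟩
    rw [heq] at h
    exact stripYT_not_mem_stripBddSet hT h
  · rintro ⟨hy0, hlt⟩
    exact mem_stripBddSet_of_lt_stripYT_of_le hT hy0 hlt hT le_rfl

/-- ★ **`stripBddSet T = [0, y_T)`** (`T ≥ 1`). [cite: BeatonBousquetMelouDeGierDuminilCopinGuttmann2014, Corollary 8 (arXiv v5 p. 12)] -/
theorem stripBddSet_eq_Ico (hT : 1 ≤ T) : stripBddSet T = Set.Ico 0 (stripYT T) :=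
  Set.ext fun _ => mem_stripBddSet_iff hT

/-- **The bridge class is bounded in `L` iff `y < y_T`** (`0 ≤ y`, `T ≥ 1`).
[cite: BeatonBousquetMelouDeGierDuminilCopinGuttmann2014, Corollary 8 (arXiv v5 p. 12)] -/
theorem bddAbove_stripGFy_beta_iff_lt_stripYT (hT : 1 ≤ T) {y : ℝ} (hy0 : 0 ≤ y) :
    BddAbove (Set.range fun L : ℕ => stripGFy T L (IsBetaDart T) y) ↔ y < stripYT T :=
  ⟨fun hb => ((mem_stripBddSet_iff hT).1 ⟨hy0, hb⟩).2, fun h => ((mem_stripBddSet_iff hT).2 ⟨hy0, h⟩).2⟩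

/-! ### Divergence of the arches AT `y_T` -/

/-- **The arch class is bounded exactly on the boundedness set**, with no exceptional point: for `0 ≤ y`,
`y ∈ stripBddSet T ↔ L ↦ A_{T,L}(x_c; y)` bounded (`T ≥ 1`; the `y ≠ y*` proviso of `mem_stripBddSet_iff_bddAbove_alpha` is removed by
`y* < y_T`). [cite: BeatonBousquetMelouDeGierDuminilCopinGuttmann2014, Corollary 8 (arXiv v5 p. 12: A_T(x_c;·) and B_T(x_c;·) have the same radius y_T; proof p. 13: "y_T > y_c for all T")] -/
theorem mem_stripBddSet_iff_bddAbove_alpha' (hT : 1 ≤ T) {y : ℝ} (hy0 : 0 ≤ y) :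
    y ∈ stripBddSet T ↔ BddAbove (Set.range fun L : ℕ => stripGFy T L IsAlphaDart y) := by
  by_cases hne : y = yStar
  · subst hne
    have hmem : yStar ∈ stripBddSet T := (mem_stripBddSet_iff hT).2 ⟨yStar_pos.le, yStar_lt_stripYT hT⟩
    exact ⟨fun _ => (stripBddSet_subset_alpha hT hmem).2, fun _ => hmem⟩
  · exact mem_stripBddSet_iff_bddAbove_alpha hT hy0 hne

/-- ★ **`A_{T,L}(x_c; y_T)` is unbounded in `L`** (`T ≥ 1`). [cite: BeatonBousquetMelouDeGierDuminilCopinGuttmann2014, Corollary 8 (arXiv v5 p. 12: A_T(x_c; ·) has radius y_T)] -/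
theorem not_bddAbove_stripGFy_alpha_stripYT (hT : 1 ≤ T) :
    ¬ BddAbove (Set.range fun L : ℕ => stripGFy T L IsAlphaDart (stripYT T)) := fun hA =>
  stripYT_not_mem_stripBddSet hT ((mem_stripBddSet_iff_bddAbove_alpha' hT (stripYT_pos hT).le).2 hA)

/-- ★ **`A_{T,L}(x_c; y_T) → +∞` as `L → ∞`**: the arch series diverges AT its radius too.
[cite: BeatonBousquetMelouDeGierDuminilCopinGuttmann2014, Corollary 8 (arXiv v5 p. 12)] -/
theorem tendsto_stripGFy_alpha_stripYT_atTop (hT : 1 ≤ T) :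
    Tendsto (fun L : ℕ => stripGFy T L IsAlphaDart (stripYT T)) atTop atTop := by
  refine tendsto_atTop_atTop_of_monotone (fun L L' hLL' => stripGFy_alpha_mono_L hLL' (stripYT_pos hT).le) fun b => ?_
  by_contra hb
  push Not at hb
  exact not_bddAbove_stripGFy_alpha_stripYT hT ⟨b, by rintro _ ⟨L, rfl⟩; exact (hb L).le⟩

/-- **The arch class is bounded in `L` iff `y < y_T`** (`0 ≤ y`, `T ≥ 1`): the radius of `A_T(x_c; ·)` is exactly `y_T`, divergence at
the radius included. [cite: BeatonBousquetMelouDeGierDuminilCopinGuttmann2014, Corollary 8 (arXiv v5 p. 12)] -/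
theorem bddAbove_stripGFy_alpha_iff_lt_stripYT (hT : 1 ≤ T) {y : ℝ} (hy0 : 0 ≤ y) :
    BddAbove (Set.range fun L : ℕ => stripGFy T L IsAlphaDart y) ↔ y < stripYT T := by
  rw [← mem_stripBddSet_iff_bddAbove_alpha' hT hy0, mem_stripBddSet_iff hT]
  exact ⟨fun h => h.2, fun h => ⟨hy0, h⟩⟩

/-! ### Series forms -/

/-- **`B_T(x_c; y) = Σ_m β_{T,m} y^m` converges iff `y < y_T`** (`0 ≤ y`, `T ≥ 1`).
[cite: BeatonBousquetMelouDeGierDuminilCopinGuttmann2014, Corollary 8 (arXiv v5 p. 12: "radius of convergence y_T")] -/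
theorem summable_stripBcoeff_iff_lt_stripYT (hT : 1 ≤ T) {y : ℝ} (hy0 : 0 ≤ y) :
    (Summable fun m => stripBcoeff T m * y ^ m) ↔ y < stripYT T := by
  have h := mem_stripBddSet_iff hT (y := y)
  rw [stripBddSet_eq_summable hT] at h
  exact ⟨fun hs => (h.1 ⟨hy0, hs⟩).2, fun hlt => (h.2 ⟨hy0, hlt⟩).2⟩

/-- ★ **The bridge series diverges AT its radius**: `Σ_m β_{T,m} y_T^m = ∞` (`T ≥ 1`).
[cite: BeatonBousquetMelouDeGierDuminilCopinGuttmann2014, Corollary 8 (arXiv v5 p. 12); lane: divergence at the radius by growth rates] -/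
theorem not_summable_stripBcoeff_stripYT (hT : 1 ≤ T) : ¬ Summable fun m => stripBcoeff T m * stripYT T ^ m :=
  not_summable_stripBcoeff hT (stripYT_pos hT).le (not_bddAbove_stripGFy_beta_stripYT hT)

/-- **The strip generating function of all walks converges iff `y < y_T`**: `Σ_n x_c^{n+1} Z_n(y) < ∞ ↔ y < y_T` (`y > 0`, `T ≥ 1`) —
"`C_T(x_c, y)` converges if `x_c < ρ_T(y)`, and diverges if `x_c > ρ_T(y)`" for the lane's translation classes, the boundary case
`x_c = ρ_T(y_T)` INCLUDED (divergence). [cite: BeatonBousquetMelouDeGierDuminilCopinGuttmann2014, proof of Corollary 8 (arXiv v5 pp. 12–13)] -/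
theorem summable_pow_mul_stripZL_iff_lt_stripYT (hT : 1 ≤ T) {y : ℝ} (hy : 0 < y) :
    (Summable fun n : ℕ => hexCriticalFugacity ^ (n + 1) * stripZL T n y) ↔ y < stripYT T := by
  obtain ⟨hx0, -⟩ := hexCriticalFugacity_pos_lt_one
  constructor
  · intro hs
    by_contra hge
    push Not at hge
    -- at y ≥ y_T the growth rate is ≥ x_c⁻¹, so the partial sums grow linearly
    have hν : hexCriticalFugacity⁻¹ ≤ stripNu T y := by
      rw [← stripNu_stripYT hT]; exact stripNu_mono_y hT (stripYT_pos hT) hge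
    have hKy : 0 < HexBW.yK y := by linarith [HexBW.one_le_yK y]
    have hnn : ∀ n, 0 ≤ hexCriticalFugacity ^ (n + 1) * stripZL T n y := fun n =>
      mul_nonneg (pow_nonneg hx0.le _) (stripZL_nonneg T n hy.le)
    obtain ⟨N, hN⟩ := exists_nat_gt (HexBW.yK y * hexCriticalFugacity⁻¹ * ∑' n, hexCriticalFugacity ^ (n + 1) * stripZL T n y)
    have h1 := succ_le_mul_sum_pow_mul_stripZL hT hy hν N
    have h2 : ∑ n ∈ range (N + 1), hexCriticalFugacity ^ n * stripZL T n y =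
        hexCriticalFugacity⁻¹ * ∑ n ∈ range (N + 1), hexCriticalFugacity ^ (n + 1) * stripZL T n y := by
      rw [mul_sum]
      refine sum_congr rfl fun n _ => ?_
      rw [pow_succ]; field_simp
    have h3 : ∑ n ∈ range (N + 1), hexCriticalFugacity ^ (n + 1) * stripZL T n y ≤
        ∑' n, hexCriticalFugacity ^ (n + 1) * stripZL T n y := hs.sum_le_tsum _ fun n _ => hnn n
    have h4 : HexBW.yK y * ∑ n ∈ range (N + 1), hexCriticalFugacity ^ n * stripZL T n y ≤
        HexBW.yK y * hexCriticalFugacity⁻¹ * ∑' n, hexCriticalFugacity ^ (n + 1) * stripZL T n y := by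
      rw [h2, ← mul_assoc]
      exact mul_le_mul_of_nonneg_left h3 (mul_nonneg hKy.le (inv_nonneg.2 hx0.le))
    linarith
  · intro hlt
    -- below y_T every bridge class h ≤ T is bounded: uniform bound on the partial sums
    have hb : ∀ h ∈ Finset.Icc 1 T, BddAbove (Set.range fun L : ℕ => stripGFy h L (IsBetaDart h) y) := fun h hh =>
      (mem_stripBddSet_of_lt_stripYT_of_le hT hy.le hlt (Finset.mem_Icc.1 hh).1 (Finset.mem_Icc.1 hh).2).2
    set K := ∑ h ∈ Finset.Icc 1 T, ⨆ L : ℕ, stripGFy h L (IsBetaDart h) y with hK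
    have hKh : ∀ h ∈ Finset.Icc 1 T, 0 ≤ ⨆ L : ℕ, stripGFy h L (IsBetaDart h) y := fun h hh =>
      le_ciSup_of_le (hb h hh) 0 (stripGFy_nonneg' h 0 _ hy.le)
    have hK0 : 0 ≤ K := sum_nonneg hKh
    have hKb : ∀ h, 1 ≤ h → h ≤ T → ∀ L, stripGFy h L (IsBetaDart h) y ≤ K := by
      intro h h1 h2 L
      have hh : h ∈ Finset.Icc 1 T := Finset.mem_Icc.2 ⟨h1, h2⟩
      exact (le_ciSup (hb h hh) L).trans (single_le_sum (f := fun h => ⨆ L : ℕ, stripGFy h L (IsBetaDart h) y) hKh hh)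
    set C := HexBW.yK y * (2 * T * G0 T * (1 + 2 * T * ((hexCriticalFugacity⁻¹ + hexCriticalFugacity⁻¹ ^ 2) * K))) ^ 2
    have hnn : ∀ n, 0 ≤ hexCriticalFugacity ^ (n + 1) * stripZL T n y := fun n =>
      mul_nonneg (pow_nonneg hx0.le _) (stripZL_nonneg T n hy.le)
    refine summable_of_sum_range_le hnn (c := hexCriticalFugacity * C) fun N => ?_
    rcases Nat.eq_zero_or_pos N with rfl | hN
    · simp only [range_zero, sum_empty]
      exact mul_nonneg hx0.le ((sum_nonneg fun n _ => mul_nonneg (pow_nonneg hx0.le _) (stripZL_nonneg T n hy.le)).trans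
        (sum_pow_mul_stripZL_le hT hy hK0 hKb 0))
    · obtain ⟨M, rfl⟩ := Nat.exists_eq_succ_of_ne_zero hN.ne'
      have h1 := sum_pow_mul_stripZL_le hT hy hK0 hKb M
      calc ∑ n ∈ range (M + 1), hexCriticalFugacity ^ (n + 1) * stripZL T n y
          = hexCriticalFugacity * ∑ n ∈ range (M + 1), hexCriticalFugacity ^ n * stripZL T n y := by
            rw [mul_sum]; exact sum_congr rfl fun n _ => by rw [pow_succ]; ring
        _ ≤ hexCriticalFugacity * C := mul_le_mul_of_nonneg_left h1 hx0.le

/-- ★ **The strip generating function of all walks diverges AT the threshold**: `Σ_n x_c^{n+1} Z_n(y_T) = ∞` (`T ≥ 1`) —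
"`ρ_T(y_T) = x_c`" with divergence on the boundary. [cite: BeatonBousquetMelouDeGierDuminilCopinGuttmann2014, Corollary 8 and its proof (arXiv v5 pp. 12–13); lane] -/
theorem not_summable_pow_mul_stripZL_stripYT (hT : 1 ≤ T) :
    ¬ Summable fun n : ℕ => hexCriticalFugacity ^ (n + 1) * stripZL T n (stripYT T) := fun hs =>
  lt_irrefl _ ((summable_pow_mul_stripZL_iff_lt_stripYT hT (stripYT_pos hT)).1 hs)

/-! ### `y_T` as the radius of the arch series; wide strips above `y*` -/

/-- **`y_T = sup {y ≥ 0 : L ↦ A_{T,L}(x_c; y) bounded}`** (`T ≥ 1`): the lane's threshold is the radius of the ARCH series too — the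
printed sentence "the series `A_T(x_c, y)` … ha[s] radius of convergence `y_T`", literally, for the lane's `y_T`.
[cite: BeatonBousquetMelouDeGierDuminilCopinGuttmann2014, Corollary 8 (arXiv v5 p. 12)] -/
theorem stripYT_eq_sSup_alpha (hT : 1 ≤ T) :
    stripYT T = sSup {y : ℝ | 0 ≤ y ∧ BddAbove (Set.range fun L : ℕ => stripGFy T L IsAlphaDart y)} := by
  have hset : {y : ℝ | 0 ≤ y ∧ BddAbove (Set.range fun L : ℕ => stripGFy T L IsAlphaDart y)} = stripBddSet T := by
    ext y
    simp only [Set.mem_setOf_eq]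
    constructor
    · rintro ⟨hy0, hA⟩; exact (mem_stripBddSet_iff_bddAbove_alpha' hT hy0).2 hA
    · intro h; exact ⟨h.1, (mem_stripBddSet_iff_bddAbove_alpha' hT h.1).1 h⟩
  rw [hset, stripYT]

/-- **Above `y*` the arches of all wide strips diverge**: for `y > y* = 1 + √2`, `L ↦ A_{T+1,L}(x_c; y)` is unbounded for all large
`T` (because `y_{T+1} → y*`). [cite: BeatonBousquetMelouDeGierDuminilCopinGuttmann2014, Corollary 8 (arXiv v5 p. 12: "y_T decreases to the critical fugacity y_c as T goes to infinity") with Theorem 2 (y_c = 1 + √2, p. 3)] -/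
theorem eventually_not_bddAbove_stripGFy_alpha_of_yStar_lt {y : ℝ} (hy : yStar < y) :
    ∀ᶠ T : ℕ in atTop, ¬ BddAbove (Set.range fun L : ℕ => stripGFy (T + 1) L IsAlphaDart y) := by
  filter_upwards [(tendsto_stripYT_yStar.eventually (gt_mem_nhds hy))] with T hT
  exact not_bddAbove_stripGFy_alpha_of_stripYT_lt (by omega) hT

/-- **Above `y*` the bridges of all wide strips diverge**: for `y > y*`, `L ↦ B_{T+1,L}(x_c; y)` is unbounded for all large `T`.
[cite: BeatonBousquetMelouDeGierDuminilCopinGuttmann2014, Corollary 8 (arXiv v5 p. 12) with Theorem 2 (p. 3)] -/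
theorem eventually_not_bddAbove_stripGFy_beta_of_yStar_lt {y : ℝ} (hy : yStar < y) :
    ∀ᶠ T : ℕ in atTop, ¬ BddAbove (Set.range fun L : ℕ => stripGFy (T + 1) L (IsBetaDart (T + 1)) y) := by
  filter_upwards [(tendsto_stripYT_yStar.eventually (gt_mem_nhds hy))] with T hT
  exact not_bddAbove_stripGFy_beta_of_stripYT_lt (by omega) hT

/-- … while at and below `y*` they converge in EVERY strip (`0 ≤ y ≤ y*`, `T ≥ 1`; at `y*` because `y* < y_T`).
[cite: BeatonBousquetMelouDeGierDuminilCopinGuttmann2014, §4.2 eq. (17) (arXiv v5 p. 14) and Corollary 8 (proof p. 13: "y_T > y_c for all T")] -/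
theorem bddAbove_stripGFy_alpha_of_le_yStar (hT : 1 ≤ T) {y : ℝ} (hy0 : 0 ≤ y) (hy : y ≤ yStar) :
    BddAbove (Set.range fun L : ℕ => stripGFy T L IsAlphaDart y) :=
  (bddAbove_stripGFy_alpha_iff_lt_stripYT hT hy0).2 (hy.trans_lt (yStar_lt_stripYT hT))

/-! ### Blow-up of the limit series as `y ↑ y_T` -/

/-- Each finite-strip class polynomial `y ↦ G_{T,L}(x_c; y)` is continuous — PRIVATE plumbing: the public statement is the tree's
`HV.continuous_stripGFy` (`HexSAWStripSurfaceLeftContinuity.lean`, not imported here). [cite: BeatonBousquetMelouDeGierDuminilCopinGuttmann2014, §2 eq. (10) (arXiv v5 p. 6: the polynomials A_{T,L}, B_{T,L}, E_{T,L})] -/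
private theorem continuous_stripGFy' (T L : ℕ) (cls : HV × HV → Prop) [DecidablePred cls] : Continuous fun y : ℝ => stripGFy T L cls y := by
  unfold stripGFy
  exact continuous_finsetSum _ fun P _ => continuous_const.mul (continuous_pow _)

/-- Generic blow-up: if the class polynomials `L ↦ G_{T,L}(y)` are unbounded at `y₀ > 0` and bounded at every `0 < y < y₀`, then
`sup_L G_{T,L}(y) → +∞` as `y ↑ y₀`. [cite: BeatonBousquetMelouDeGierDuminilCopinGuttmann2014, Corollary 8 (arXiv v5 p. 12: radius of convergence y_T; rational series, p. 12 "a rational function of x and y")] -/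
theorem tendsto_ciSup_stripGFy_nhdsLT_atTop (T : ℕ) (cls : HV × HV → Prop) [DecidablePred cls] {y₀ : ℝ} (hy₀ : 0 < y₀)
    (hunb : ¬ BddAbove (Set.range fun L : ℕ => stripGFy T L cls y₀))
    (hbdd : ∀ y, 0 < y → y < y₀ → BddAbove (Set.range fun L : ℕ => stripGFy T L cls y)) :
    Tendsto (fun y : ℝ => ⨆ L : ℕ, stripGFy T L cls y) (𝓝[<] y₀) atTop := by
  rw [tendsto_atTop]
  intro K
  -- one length L with G_{T,L}(y₀) > K
  have hL : ∃ L : ℕ, K < stripGFy T L cls y₀ := by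
    by_contra h
    push Not at h
    exact hunb ⟨K, by rintro _ ⟨L, rfl⟩; exact h L⟩
  obtain ⟨L, hL⟩ := hL
  -- continuity in y at y₀, restricted to the left, inside (0, y₀)
  have hcont : ∀ᶠ y in 𝓝 y₀, K < stripGFy T L cls y :=
    (continuous_stripGFy' T L cls).continuousAt.eventually (lt_mem_nhds hL)
  have hIoo : ∀ᶠ y in 𝓝[<] y₀, y ∈ Set.Ioo 0 y₀ := Ioo_mem_nhdsLT hy₀
  filter_upwards [nhdsWithin_le_nhds hcont, hIoo] with y hy hmem
  exact hy.le.trans (le_ciSup (hbdd y hmem.1 hmem.2) L)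

/-- ★ **`B_T(x_c; y) → +∞` as `y ↑ y_T`** (`T ≥ 1`): the bridge series blows up at its radius in the fugacity variable.
[cite: BeatonBousquetMelouDeGierDuminilCopinGuttmann2014, Corollary 8 (arXiv v5 p. 12); lane: Pringsheim-type form for the lane's sup-over-L series] -/
theorem tendsto_stripByLim_nhdsLT_stripYT (hT : 1 ≤ T) :
    Tendsto (fun y : ℝ => stripByLim T y) (𝓝[<] stripYT T) atTop :=
  tendsto_ciSup_stripGFy_nhdsLT_atTop T (IsBetaDart T) (stripYT_pos hT) (not_bddAbove_stripGFy_beta_stripYT hT)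
    fun _ hy hlt => (bddAbove_stripGFy_beta_iff_lt_stripYT hT hy.le).2 hlt

/-- ★ **`A_T(x_c; y) → +∞` as `y ↑ y_T`** (`T ≥ 1`): the arch series blows up at its radius in the fugacity variable.
[cite: BeatonBousquetMelouDeGierDuminilCopinGuttmann2014, Corollary 8 (arXiv v5 p. 12); lane] -/
theorem tendsto_stripAyLim_nhdsLT_stripYT (hT : 1 ≤ T) :
    Tendsto (fun y : ℝ => stripAyLim T y) (𝓝[<] stripYT T) atTop :=
  tendsto_ciSup_stripGFy_nhdsLT_atTop T IsAlphaDart (stripYT_pos hT) (not_bddAbove_stripGFy_alpha_stripYT hT)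
    fun _ hy hlt => (bddAbove_stripGFy_alpha_iff_lt_stripYT hT hy.le).2 hlt

end Literature.Probability.RandomPlanarGeometry.SAW.HV

/- ═════ ONE-CAR edition: begin PART IV «THRESHOLD-DIVERGENCE-RATE» R ed.5 d70fde2f7f2ccf58 (a-p2 g11/g12) — body VERBATIM (imports hoisted) ═════ -/

/-!
# A rate of divergence at the threshold: `B_{T,L}(x_c; y_T) ≥ c_T √L` for large `L` (BBdGDCG14 Corollary 8, quantified)

Topic `Literature/Probability/RandomPlanarGeometry` (continues `HexSAWStripSurfaceThresholdRate.lean`, merged edition — its PART 3 «THRESHOLD-DIVERGENCE»: AT the lane threshold `y_T`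
the bridge class `L ↦ B_{T,L}(x_c; y_T)` of the Duminil-Copin–Smirnov strip `S_T` is unbounded (`HV.not_bddAbove_stripGFy_beta_stripYT`),
by Fekete's infimum form `N + 1 ≤ max(1, y⁻¹) Σ_{n ≤ N} x_cⁿ Z_n(y_T)` (`HV.succ_le_mul_sum_pow_mul_stripZL`) played against the
finite Hammersley–Welsh-type decomposition INSIDE the strip of `HexSAWStripSurfaceGrowthBounds.lean` (`HV.sum_allTo_wgt_le`,
`HV.sum_upTo_wgt_le`, `HV.sum_allTo_pow_le`, `HV.shift_mem_bridgeLists_false`, `HV.cons_shift_mem_bridgeLists_true`) —, and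
`HexSAWStripSurfaceThresholdRate.lean` (`HV.stripYT_succ_lt`: `y_{T} < y_h` for `h < T`).  Source: N. R. Beaton, M. Bousquet-Mélou,
J. de Gier, H. Duminil-Copin, A. J. Guttmann, *The critical fugacity for surface adsorption of self-avoiding walks on the honeycomb
lattice is `1 + √2`*, Comm. Math. Phys. 326 (2014) 727–754, arXiv:1109.0358v5, §3.2, Corollary 8 (p. 12): "The series (in `y`)
`A_T(x_c, y)`, `B_T(x_c, y)` and `C_T(x_c, y)` have radius of convergence `y_T`" (rational series, p. 12: "a rational function of `x`
and `y`" — so in print the divergence at `y_T` is that of a pole; no rate in `L` is printed).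

## What is proved (namespace `Literature.Probability.RandomPlanarGeometry.SAW.HV`; `T ≥ 1`; standard axioms)

The decomposition bound of `HexSAWStripSurfaceGrowthBounds.lean` is re-assembled with the bridge bound needed only AT THE SAME cut-off
(`sum_wbTo_wgt_le_at`, `sum_pow_mul_stripZL_le_at`: if `B_{h,N}(x_c; y) ≤ K` for `1 ≤ h ≤ T` then
`Σ_{n ≤ N} x_cⁿ Z_n(y) ≤ max(1,y⁻¹) (2T G₀ (1 + 2T (x_c⁻¹ + x_c⁻²) K))²`).  At `y = y_T` the left side is `≥ (N+1)/max(1,y_T⁻¹)` while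
the lower strips `h < T` contribute bounded amounts (`y_T < y_h`), whence

* ★ **`exists_sqrt_le_stripGFy_beta_stripYT`** — there are `c > 0` and `C` (depending on `T`) with
  `c · √(N + 1) − C ≤ B_{T,N}(x_c; y_T)` for EVERY `N`: the bridge class diverges AT the threshold at least like `√N`;
* `G0_pos` — `G₀(T) > 0` (a by-product);
* ★ **`exists_sqrt_le_stripGFy_alpha_stripYT`** — the same rate for the ARCHES: `c' · √(N + 1) − C' ≤ A_{T,N+1}(x_c; y_T)` with
  `c' = |β(y_T)| c / (cos(3π/8) + cos(π/4) x_c^{1−2T}) > 0` (identity (16) at `y_T > y*`, the side term converted into arches by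
  `HexSAWStripSurfaceArchRadius.lean`);
* `tendsto_div_stripGFy_beta_stripYT` — AT `y_T`, `(cos(3π/8) A_{T,L} + cos(π/4) E_{T,L})/B_{T,L} → −β(y_T) = (y_T − y*)/(√2 y_T)` as
  `L → ∞`: the classes diverge in the fixed proportion set by `β(y_T)` (identity (16) with `B_{T,L}(y_T) → ∞`);
* `tendsto_div_stripAyLim_stripByLim_nhdsLT_stripYT` — as `y ↑ y_T`, `A_T(x_c; y)/B_T(x_c; y) → −β(y_T)/cos(3π/8)`: the exact ratio of
  the two blow-ups (Proposition 9 on `(0, y_T)` — PART 2 «LIMITS-FULL» of the same module — with `B_T(x_c; y) → ∞`).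

Label: NEW-IN-WRITING (XS/modest): a quantitative LOWER rate, in the strip length, of the divergence at the radius (print: pole of a
rational function, no `L`-rate stated); the true order in `L` is not determined here (a simple pole would suggest linear growth — unproved,
unclaimed).  Lane «pcv-sawmu», a-p2 g11, 2026-08-23 (ed.4: lit-1 g16 remark TR1, docstring-only).
-/

noncomputable section

open Finset Filter Topology

namespace Literature.Probability.RandomPlanarGeometry.SAW.HV

variable {T N : ℕ}

/-! ### The decomposition bound with the bridge bound at the same cut-off -/

/-- `Σ_{b ∈ wbTo T N} wgt b ≤ 2T (x_c⁻¹ + x_c⁻²) K` whenever `B_{h,N}(x_c; y) ≤ K` for `1 ≤ h ≤ T` — the bound of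
`HV.sum_wbTo_wgt_le` with its hypothesis needed only at the cut-off `L = N` (the weak bridges of chains with `≤ N` steps are bridges of
`S_{h,N}`). [cite: DuminilCopinSmirnov2012, §3 (bridges of S_{T,L}); BeatonBousquetMelouDeGierDuminilCopinGuttmann2014, Corollary 8 (arXiv v5 p. 12); lane: same proof as `sum_wbTo_wgt_le`] -/
theorem sum_wbTo_wgt_le_at (T N : ℕ) {y K : ℝ} (hy : 0 ≤ y) (hK0 : 0 ≤ K)
    (hK : ∀ h, 1 ≤ h → h ≤ T → stripGFy h N (IsBetaDart h) y ≤ K) :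
    ∑ b ∈ wbTo T N, wgt T y b ≤ 2 * T * ((hexCriticalFugacity⁻¹ + hexCriticalFugacity⁻¹ ^ 2) * K) := by
  classical
  have hx := hexCriticalFugacity_pos_lt_one.1
  have hmaps : ∀ b ∈ wbTo T N, b.headD hvOrigin ∈ stdHeads T := by
    intro b hb
    rw [wbTo, mem_filter, upTo, mem_filter] at hb
    obtain ⟨hch, hnd, hne, hlen, ⟨v, hh, hv⟩, hin⟩ := mem_allTo_iff.1 hb.1.1
    rw [List.headD_eq_head?_getD, hh, Option.getD_some]
    exact mem_stdHeads_iff.2 ⟨hv, hin v (List.mem_of_mem_head? hh)⟩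
  rw [← sum_fiberwise_of_maps_to hmaps]
  have hfib : ∀ v ∈ stdHeads T, ∑ b ∈ (wbTo T N).filter (fun b => b.headD hvOrigin = v), wgt T y b ≤
      (hexCriticalFugacity⁻¹ + hexCriticalFugacity⁻¹ ^ 2) * K := by
    intro v hv
    rw [stdHeads, mem_image] at hv
    obtain ⟨⟨j, bb⟩, hjb, rfl⟩ := hv
    rw [mem_product, mem_range] at hjb
    obtain ⟨hj', -⟩ := hjb
    have hj : j < T := by simpa using hj'
    have hB : ∑ l ∈ bridgeLists (T - j) N, brTerm (T - j) y l ≤ K := by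
      have := hK (T - j) (by omega) (Nat.sub_le T j)
      rw [stripGFy_beta_eq_sum_bridgeLists (by omega)] at this
      simpa only [brTerm] using this
    have hbr0 : ∀ l ∈ bridgeLists (T - j) N, 0 ≤ brTerm (T - j) y l := fun l _ =>
      mul_nonneg (pow_nonneg hx.le _) (pow_nonneg hy _)
    have hi1 : 0 ≤ hexCriticalFugacity⁻¹ := inv_nonneg.2 hx.le
    cases bb
    · calc ∑ b ∈ (wbTo T N).filter (fun b => b.headD hvOrigin = ((0 : ℤ), (j : ℤ), false)), wgt T y b
          = ∑ b ∈ (wbTo T N).filter (fun b => b.headD hvOrigin = ((0 : ℤ), (j : ℤ), false)),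
              hexCriticalFugacity⁻¹ * brTerm (T - j) y (b.map (shift 0 (-(j : ℤ)))) :=
            sum_congr rfl fun b hb => (shift_mem_bridgeLists_false (mem_filter.1 hb).1 hj (mem_filter.1 hb).2).2
        _ ≤ ∑ l ∈ bridgeLists (T - j) N, hexCriticalFugacity⁻¹ * brTerm (T - j) y l := by
            refine sum_le_sum_of_injOn_of_nonneg (fun b => b.map (shift 0 (-(j : ℤ)))) ?_
              (fun b hb => (shift_mem_bridgeLists_false (y := y) (mem_filter.1 hb).1 hj (mem_filter.1 hb).2).1)
              (fun l => hexCriticalFugacity⁻¹ * brTerm (T - j) y l) fun l hl => mul_nonneg hi1 (hbr0 l hl)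
            intro b _ b' _ h
            exact (List.map_injective_iff.2 (shift _ _).injective) h
        _ ≤ (hexCriticalFugacity⁻¹ + hexCriticalFugacity⁻¹ ^ 2) * K := by
            rw [← mul_sum]; nlinarith [mul_nonneg (sq_nonneg hexCriticalFugacity⁻¹) hK0]
    · calc ∑ b ∈ (wbTo T N).filter (fun b => b.headD hvOrigin = ((0 : ℤ), (j : ℤ), true)), wgt T y b
          = ∑ b ∈ (wbTo T N).filter (fun b => b.headD hvOrigin = ((0 : ℤ), (j : ℤ), true)),
              hexCriticalFugacity⁻¹ ^ 2 * brTerm (T - j) y (hvOrigin :: b.map (shift 0 (-(j : ℤ)))) :=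
            sum_congr rfl fun b hb => (cons_shift_mem_bridgeLists_true (mem_filter.1 hb).1 hj (mem_filter.1 hb).2).2
        _ ≤ ∑ l ∈ bridgeLists (T - j) N, hexCriticalFugacity⁻¹ ^ 2 * brTerm (T - j) y l := by
            refine sum_le_sum_of_injOn_of_nonneg (fun b => hvOrigin :: b.map (shift 0 (-(j : ℤ)))) ?_
              (fun b hb => (cons_shift_mem_bridgeLists_true (y := y) (mem_filter.1 hb).1 hj (mem_filter.1 hb).2).1)
              (fun l => hexCriticalFugacity⁻¹ ^ 2 * brTerm (T - j) y l) fun l hl => mul_nonneg (sq_nonneg _) (hbr0 l hl)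
            intro b _ b' _ h
            exact (List.map_injective_iff.2 (shift _ _).injective) (List.cons.inj h).2
        _ ≤ (hexCriticalFugacity⁻¹ + hexCriticalFugacity⁻¹ ^ 2) * K := by
            rw [← mul_sum]; nlinarith [mul_nonneg hi1 hK0]
  calc ∑ v ∈ stdHeads T, ∑ b ∈ (wbTo T N).filter (fun b => b.headD hvOrigin = v), wgt T y b
      ≤ ∑ _v ∈ stdHeads T, (hexCriticalFugacity⁻¹ + hexCriticalFugacity⁻¹ ^ 2) * K := sum_le_sum hfib
    _ = (stdHeads T).card * ((hexCriticalFugacity⁻¹ + hexCriticalFugacity⁻¹ ^ 2) * K) := by rw [sum_const, nsmul_eq_mul]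
    _ ≤ 2 * T * ((hexCriticalFugacity⁻¹ + hexCriticalFugacity⁻¹ ^ 2) * K) := by
        refine mul_le_mul_of_nonneg_right ?_ (by positivity)
        exact_mod_cast card_stdHeads_le T

/-- **The decomposition bound at the cut-off**: if `B_{h,N}(x_c; y) ≤ K` for `1 ≤ h ≤ T` (`y > 0`), then
`Σ_{n ≤ N} x_cⁿ Z_n(y) ≤ max(1,y⁻¹) · (2T G₀ (1 + 2T (x_c⁻¹ + x_c⁻²) K))²`.
[cite: DuminilCopinSmirnov2012, §3 ("Z(x) ≤ … ∏ (1 + B_T^x)²"); BeatonBousquetMelouDeGierDuminilCopinGuttmann2014, Corollary 8 (arXiv v5 p. 12); lane: `sum_pow_mul_stripZL_le` with the bridge bound at L = N] -/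
theorem sum_pow_mul_stripZL_le_at (hT : 1 ≤ T) {y K : ℝ} (hy : 0 < y) (hK0 : 0 ≤ K) (N : ℕ)
    (hK : ∀ h, 1 ≤ h → h ≤ T → stripGFy h N (IsBetaDart h) y ≤ K) :
    ∑ n ∈ range (N + 1), hexCriticalFugacity ^ n * stripZL T n y ≤
      HexBW.yK y * (2 * T * G0 T * (1 + 2 * T * ((hexCriticalFugacity⁻¹ + hexCriticalFugacity⁻¹ ^ 2) * K))) ^ 2 := by
  have hx := hexCriticalFugacity_pos_lt_one.1
  have hKy := HexBW.one_le_yK y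
  have hA := sum_allTo_pow_le hT N
  have hA0 : 0 ≤ ∑ c ∈ allTo T N, hexCriticalFugacity ^ (c.length - 1) := sum_nonneg fun _ _ => pow_nonneg hx.le _
  have hW := sum_wbTo_wgt_le_at T N hy.le hK0 hK
  have hW0 : 0 ≤ ∑ b ∈ wbTo T N, wgt T y b := sum_nonneg fun _ _ => wgt_nonneg T hy.le _
  have hU := sum_upTo_wgt_le T N hy.le
  have hU0 : 0 ≤ ∑ p ∈ upTo T N, wgt T y p := sum_nonneg fun _ _ => wgt_nonneg T hy.le _
  rw [sum_pow_mul_stripZL_eq]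
  refine (sum_allTo_wgt_le T N hy).trans (mul_le_mul_of_nonneg_left ?_ (by linarith))
  refine pow_le_pow_left₀ hU0 (hU.trans ?_) 2
  exact mul_le_mul hA (by linarith) (by linarith) (mul_nonneg (by positivity) (G0_nonneg T))

/-! ### The rate at the threshold -/

/-- The lower strips stay bounded at `y_T`: for `1 ≤ h < T`, `B_{h,L}(x_c; y_T) ≤ B_h(x_c; y_T) < ∞` uniformly in `L` (because
`y_T < y_h`). [cite: BeatonBousquetMelouDeGierDuminilCopinGuttmann2014, Corollary 8 (arXiv v5 p. 12; proof p. 13: "y_{T+1} < y_T")] -/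
theorem exists_bound_stripGFy_beta_lt (hT : 1 ≤ T) :
    ∃ M : ℝ, 0 ≤ M ∧ ∀ h, 1 ≤ h → h < T → ∀ L, stripGFy h L (IsBetaDart h) (stripYT T) ≤ M := by
  classical
  -- each lower strip is bounded at y_T: y_T < y_h
  have hb : ∀ h ∈ Finset.Ico 1 T, BddAbove (Set.range fun L : ℕ => stripGFy h L (IsBetaDart h) (stripYT T)) := by
    intro h hh
    obtain ⟨h1, h2⟩ := Finset.mem_Ico.1 hh
    have hlt : stripYT T < stripYT h := by
      obtain ⟨h', rfl⟩ := Nat.exists_eq_add_of_le' h1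
      obtain ⟨T', rfl⟩ := Nat.exists_eq_add_of_le' hT
      have : (fun T : ℕ => stripYT (T + 1)) T' < (fun T : ℕ => stripYT (T + 1)) h' :=
        strictAnti_stripYT_succ (show h' < T' by omega)
      simpa using this
    exact (bddAbove_stripGFy_beta_iff_lt_stripYT h1 (stripYT_pos hT).le).2 hlt
  set M := ∑ h ∈ Finset.Ico 1 T, ⨆ L : ℕ, stripGFy h L (IsBetaDart h) (stripYT T) with hM
  have hMh : ∀ h ∈ Finset.Ico 1 T, 0 ≤ ⨆ L : ℕ, stripGFy h L (IsBetaDart h) (stripYT T) := fun h hh =>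
    le_ciSup_of_le (hb h hh) 0 (stripGFy_nonneg' h 0 _ (stripYT_pos hT).le)
  refine ⟨M, sum_nonneg hMh, fun h h1 h2 L => ?_⟩
  have hh : h ∈ Finset.Ico 1 T := Finset.mem_Ico.2 ⟨h1, h2⟩
  exact (le_ciSup (hb h hh) L).trans
    (single_le_sum (f := fun h => ⨆ L : ℕ, stripGFy h L (IsBetaDart h) (stripYT T)) hMh hh)

/-- **`G₀(T) > 0`** for `T ≥ 1` (the unweighted lower-strip series has the empty-length term; here read off the two inequalities at
`N = 0`). [cite: BeatonBousquetMelouDeGierDuminilCopinGuttmann2014, Proposition 6 (arXiv v5 p. 10)] -/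
theorem G0_pos (hT : 1 ≤ T) : 0 < G0 T := by
  obtain ⟨M, hM0, hM⟩ := exists_bound_stripGFy_beta_lt hT
  have hy := stripYT_pos hT
  set K := max M (stripGFy T 0 (IsBetaDart T) (stripYT T)) with hK
  have hK0 : 0 ≤ K := hM0.trans (le_max_left _ _)
  have hKb : ∀ h, 1 ≤ h → h ≤ T → stripGFy h 0 (IsBetaDart h) (stripYT T) ≤ K := by
    intro h h1 h2
    rcases h2.lt_or_eq with hlt | rfl
    · exact (hM h h1 hlt 0).trans (le_max_left _ _)
    · exact le_max_right _ _
  have h1 := succ_le_mul_sum_pow_mul_stripZL hT hy (stripNu_stripYT hT).ge 0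
  have h2 := sum_pow_mul_stripZL_le_at hT hy hK0 0 hKb
  have hKy : 0 < HexBW.yK (stripYT T) := by linarith [HexBW.one_le_yK (stripYT T)]
  by_contra hG
  have hG0 : G0 T = 0 := le_antisymm (not_lt.1 hG) (G0_nonneg T)
  rw [hG0] at h2
  simp only [mul_zero, zero_mul, ne_eq, OfNat.ofNat_ne_zero, not_false_eq_true, zero_pow] at h2
  have : (0 : ℝ) + 1 ≤ HexBW.yK (stripYT T) * 0 := by
    simpa using h1.trans (mul_le_mul_of_nonneg_left h2 hKy.le)
  linarith

/-- ★ **A rate of divergence at the threshold**: there are `c > 0` and `C` (depending on `T ≥ 1`) such that for every `N`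
`c · √(N + 1) − C ≤ B_{T,N}(x_c; y_T)` — the bridge class of the strip diverges at its threshold at least like the square root of the
length.  Explicitly `c = 1/(max(1,y_T⁻¹) · 2T G₀(T) · 2T (x_c⁻¹ + x_c⁻²))` and `C = 1/(2T (x_c⁻¹ + x_c⁻²)) + M_T`, `M_T` a
bound for the lower strips `h < T` at `y_T`.
[cite: BeatonBousquetMelouDeGierDuminilCopinGuttmann2014, Corollary 8 (arXiv v5 p. 12: radius y_T; rational series); lane: NEW quantitative form (no L-rate in print)] -/
theorem exists_sqrt_le_stripGFy_beta_stripYT (hT : 1 ≤ T) :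
    ∃ c : ℝ, 0 < c ∧ ∃ C : ℝ, ∀ N : ℕ, c * Real.sqrt ((N : ℝ) + 1) - C ≤ stripGFy T N (IsBetaDart T) (stripYT T) := by
  obtain ⟨M, hM0, hM⟩ := exists_bound_stripGFy_beta_lt hT
  have hy := stripYT_pos hT
  have hx := hexCriticalFugacity_pos_lt_one.1
  have hG := G0_pos hT
  have hKy1 := HexBW.one_le_yK (stripYT T)
  have hT0 : (0 : ℝ) < T := by exact_mod_cast hT
  have hd0 : 0 < hexCriticalFugacity⁻¹ + hexCriticalFugacity⁻¹ ^ 2 := by have := inv_pos.2 hx; positivity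
  -- the constants
  set Y := HexBW.yK (stripYT T) with hYdef
  set d := hexCriticalFugacity⁻¹ + hexCriticalFugacity⁻¹ ^ 2 with hd
  have hY0 : 0 < Y := by linarith
  set W := Y * (2 * T * G0 T) * (2 * T * d) with hW
  have hW0 : 0 < W := by rw [hW]; positivity
  have hTd : 0 < 2 * (T : ℝ) * d := by positivity
  refine ⟨W⁻¹, inv_pos.2 hW0, 1 / (2 * T * d) + M, fun N => ?_⟩
  set B := stripGFy T N (IsBetaDart T) (stripYT T) with hB
  have hB0 : 0 ≤ B := stripGFy_nonneg' T N _ hy.le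
  -- K := max M B bounds every class h ≤ T at the cut-off N
  have hK0 : 0 ≤ max M B := hM0.trans (le_max_left _ _)
  have hKb : ∀ h, 1 ≤ h → h ≤ T → stripGFy h N (IsBetaDart h) (stripYT T) ≤ max M B := by
    intro h h1 h2
    rcases h2.lt_or_eq with hlt | rfl
    · exact (hM h h1 hlt N).trans (le_max_left _ _)
    · exact le_max_right _ _
  have hKle : max M B ≤ M + B := max_le (by linarith) (by linarith)
  -- (N+1) ≤ Y Σ ≤ Y·Y·(a(1 + 2T d K))² = (Y a (1 + 2T d K))²
  have h1 := succ_le_mul_sum_pow_mul_stripZL hT hy (stripNu_stripYT hT).ge N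
  have h2 := sum_pow_mul_stripZL_le_at hT hy hK0 N hKb
  set X := Y * (2 * T * G0 T * (1 + 2 * T * (d * max M B))) with hX
  have hX0 : 0 ≤ X := by
    rw [hX]
    have h2T : (0 : ℝ) ≤ 2 * T := by positivity
    exact mul_nonneg hY0.le (mul_nonneg (mul_nonneg h2T hG.le)
      (add_nonneg zero_le_one (mul_nonneg h2T (mul_nonneg hd0.le hK0))))
  have h3 : (N : ℝ) + 1 ≤ X ^ 2 := by
    have h2' := mul_le_mul_of_nonneg_left h2 hY0.le
    have e : Y * (Y * (2 * T * G0 T * (1 + 2 * T * (d * max M B))) ^ 2) = X ^ 2 := by rw [hX]; ring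
    linarith [h1, h2', e.le, e.ge]
  have h4 : Real.sqrt ((N : ℝ) + 1) ≤ X := by
    rw [← Real.sqrt_sq hX0]
    exact Real.sqrt_le_sqrt h3
  -- X = Y·2T·G₀ + W·K ≤ W (1/(2Td) + M + B)
  have h5 : X ≤ W * (1 / (2 * T * d) + M + B) := by
    have e1 : X = Y * (2 * T * G0 T) + W * max M B := by rw [hX, hW]; ring
    have e2 : W * (1 / (2 * T * d) + M + B) = Y * (2 * T * G0 T) + W * (M + B) := by
      rw [hW]; field_simp; ring
    rw [e1, e2]
    have := mul_le_mul_of_nonneg_left hKle hW0.le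
    linarith
  have h6 : W⁻¹ * Real.sqrt ((N : ℝ) + 1) ≤ 1 / (2 * T * d) + M + B := by
    rw [inv_mul_le_iff₀ hW0]
    exact h4.trans h5
  linarith

/-- The same rate in "eventually" form: for every `c' < c_T`, `B_{T,N}(x_c; y_T) ≥ c' √N` for all large `N`; stated with the explicit
witness: `∃ c > 0, ∀ᶠ N, c · √N ≤ B_{T,N}(x_c; y_T)`. [cite: BeatonBousquetMelouDeGierDuminilCopinGuttmann2014, Corollary 8 (arXiv v5 p. 12); lane] -/
theorem eventually_sqrt_le_stripGFy_beta_stripYT (hT : 1 ≤ T) :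
    ∃ c : ℝ, 0 < c ∧ ∀ᶠ N : ℕ in atTop, c * Real.sqrt (N : ℝ) ≤ stripGFy T N (IsBetaDart T) (stripYT T) := by
  obtain ⟨c, hc, C, hC⟩ := exists_sqrt_le_stripGFy_beta_stripYT hT
  refine ⟨c / 2, by positivity, ?_⟩
  -- for large N: (c/2)√N ≤ c√(N+1) − C  ⟸  C ≤ (c/2)√N  (and √N ≤ √(N+1))
  have hev : ∀ᶠ N : ℕ in atTop, C ≤ c / 2 * Real.sqrt (N : ℝ) := by
    have ht : Tendsto (fun N : ℕ => c / 2 * Real.sqrt (N : ℝ)) atTop atTop :=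
      (Real.tendsto_sqrt_atTop.comp tendsto_natCast_atTop_atTop).const_mul_atTop (by positivity)
    exact ht.eventually_ge_atTop C
  filter_upwards [hev] with N hN
  have hs : Real.sqrt (N : ℝ) ≤ Real.sqrt ((N : ℝ) + 1) := Real.sqrt_le_sqrt (by linarith)
  have := hC N
  nlinarith

/-- ★ **The arches diverge at the threshold at least like `√N` too**: there are `c' > 0`, `C'` with
`c' · √(N + 1) − C' ≤ A_{T,N+1}(x_c; y_T)` for every `N` (`T ≥ 1`) — identity (16) at `y = y_T > y*` reads
`cos(3π/8) A_{T,N} + cos(π/4) E_{T,N} = 1 + |β(y_T)| B_{T,N}`, and `E_{T,N} ≤ x_c^{1−2T} A_{T,N+1}`, `A_{T,N} ≤ A_{T,N+1}`.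
[cite: BeatonBousquetMelouDeGierDuminilCopinGuttmann2014, §4.1 eq. (16) (arXiv v5 p. 13) and Corollary 8 (p. 12); lane: NEW quantitative form] -/
theorem exists_sqrt_le_stripGFy_alpha_stripYT (hT : 1 ≤ T) :
    ∃ c : ℝ, 0 < c ∧ ∃ C : ℝ, ∀ N : ℕ, c * Real.sqrt ((N : ℝ) + 1) - C ≤ stripGFy T (N + 1) IsAlphaDart (stripYT T) := by
  obtain ⟨c, hc, C, hC⟩ := exists_sqrt_le_stripGFy_beta_stripYT hT
  have hy := stripYT_pos hT
  have hβ : 0 < -betaY (stripYT T) := by linarith [betaY_neg_of_yStar_lt (yStar_lt_stripYT hT)]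
  have hcα := cos_three_pi_div_eight_pos
  have hcε := cos_pi_div_four_pos'
  have hxi : 0 < (hexCriticalFugacity ^ (2 * T - 1))⁻¹ := inv_pos.2 (pow_pos hexCriticalFugacity_pos_lt_one.1 _)
  set D := Real.cos (3 * Real.pi / 8) + Real.cos (Real.pi / 4) * (hexCriticalFugacity ^ (2 * T - 1))⁻¹ with hD
  have hD0 : 0 < D := by rw [hD]; positivity
  refine ⟨-betaY (stripYT T) * c / D, by positivity, -betaY (stripYT T) * C / D, fun N => ?_⟩
  have hid := stripIdentityY_holds T N (stripYT T) hT hy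
  have hE := stripGFy_eps_le_mul_alpha_succ hT N hy.le
  have hA := stripGFy_alpha_mono_L (T := T) (Nat.le_succ N) hy.le
  have hB := hC N
  -- D · A_{N+1} ≥ cos(3π/8) A_N + cos(π/4) E_N = 1 − β B_N ≥ (−β)(c√ − C)
  have h1 : Real.cos (3 * Real.pi / 8) * stripGFy T N IsAlphaDart (stripYT T) +
      Real.cos (Real.pi / 4) * stripGFy T N (IsEpsDart N) (stripYT T) ≤ D * stripGFy T (N + 1) IsAlphaDart (stripYT T) := by
    rw [hD, add_mul, mul_assoc]
    exact add_le_add (mul_le_mul_of_nonneg_left hA hcα.le) (mul_le_mul_of_nonneg_left hE hcε.le)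
  have h2 : -betaY (stripYT T) * (c * Real.sqrt ((N : ℝ) + 1) - C) ≤ D * stripGFy T (N + 1) IsAlphaDart (stripYT T) := by
    have := mul_le_mul_of_nonneg_left hB hβ.le
    nlinarith
  have e : -betaY (stripYT T) * c / D * Real.sqrt ((N : ℝ) + 1) - -betaY (stripYT T) * C / D =
      -betaY (stripYT T) * (c * Real.sqrt ((N : ℝ) + 1) - C) / D := by ring
  rw [e, div_le_iff₀ hD0]
  linarith

/-! ### The proportions of the blow-up -/

/-- **At `y_T` the classes diverge in a fixed proportion**: `(cos(3π/8) A_{T,L}(x_c;y_T) + cos(π/4) E_{T,L}(x_c;y_T))/B_{T,L}(x_c;y_T)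
→ −β(y_T)` as `L → ∞` (`T ≥ 1`; identity (16) reads `cos(3π/8)A + cos(π/4)E = 1 − β B` at every `L`, and `B_{T,L}(y_T) → ∞`).
[cite: BeatonBousquetMelouDeGierDuminilCopinGuttmann2014, §4.1 eq. (16) (arXiv v5 p. 13) and Corollary 8 (p. 12); lane] -/
theorem tendsto_div_stripGFy_beta_stripYT (hT : 1 ≤ T) :
    Tendsto (fun L : ℕ => (Real.cos (3 * Real.pi / 8) * stripGFy T L IsAlphaDart (stripYT T) +
        Real.cos (Real.pi / 4) * stripGFy T L (IsEpsDart L) (stripYT T)) / stripGFy T L (IsBetaDart T) (stripYT T))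
      atTop (𝓝 (-betaY (stripYT T))) := by
  have hy := stripYT_pos hT
  have hB := tendsto_stripGFy_beta_stripYT_atTop hT
  -- the quotient equals 1/B_L − β(y_T) wherever B_L ≠ 0
  have hev : ∀ᶠ L : ℕ in atTop, (Real.cos (3 * Real.pi / 8) * stripGFy T L IsAlphaDart (stripYT T) +
      Real.cos (Real.pi / 4) * stripGFy T L (IsEpsDart L) (stripYT T)) / stripGFy T L (IsBetaDart T) (stripYT T) =
      (stripGFy T L (IsBetaDart T) (stripYT T))⁻¹ - betaY (stripYT T) := by
    filter_upwards [hB.eventually_gt_atTop 0] with L hL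
    have hid := stripIdentityY_holds T L (stripYT T) hT hy
    field_simp
    linarith
  rw [tendsto_congr' hev]
  have h0 : Tendsto (fun L : ℕ => (stripGFy T L (IsBetaDart T) (stripYT T))⁻¹) atTop (𝓝 0) := hB.inv_tendsto_atTop
  simpa using h0.sub_const (betaY (stripYT T))

/-- **As `y ↑ y_T` the two series blow up in the exact ratio `A_T(x_c; y)/B_T(x_c; y) → −β(y_T)/cos(3π/8)`** (`T ≥ 1`): Proposition 9,
`cos(3π/8) A_T + β(y) B_T = 1` on `(0, y_T)`, divided by `B_T(x_c; y) → +∞`.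
[cite: BeatonBousquetMelouDeGierDuminilCopinGuttmann2014, Proposition 9 eq. (18) (arXiv v5 p. 14) and Corollary 8 (p. 12); lane] -/
theorem tendsto_div_stripAyLim_stripByLim_nhdsLT_stripYT (hT : 1 ≤ T) :
    Tendsto (fun y : ℝ => stripAyLim T y / stripByLim T y) (𝓝[<] stripYT T)
      (𝓝 (-betaY (stripYT T) / Real.cos (3 * Real.pi / 8))) := by
  have hy := stripYT_pos hT
  have hcα := cos_three_pi_div_eight_pos
  have hB := tendsto_stripByLim_nhdsLT_stripYT hT
  -- on (0, y_T) near y_T:  A/B = (1/B − β(y)) / cos(3π/8)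
  have hIoo : ∀ᶠ y in 𝓝[<] stripYT T, y ∈ Set.Ioo 0 (stripYT T) := Ioo_mem_nhdsLT hy
  have hev : ∀ᶠ y in 𝓝[<] stripYT T, stripAyLim T y / stripByLim T y =
      ((stripByLim T y)⁻¹ - betaY y) / Real.cos (3 * Real.pi / 8) := by
    filter_upwards [hIoo, hB.eventually_gt_atTop 0] with y hmem hpos
    have hid := strip_identity_limY_of_lt_stripYT hT hmem.1 hmem.2
    field_simp
    linarith
  rw [tendsto_congr' hev]
  have h0 : Tendsto (fun y : ℝ => (stripByLim T y)⁻¹) (𝓝[<] stripYT T) (𝓝 0) := hB.inv_tendsto_atTop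
  -- β is continuous at y_T (y_T ≠ 0)
  have hβ : Tendsto (fun y : ℝ => betaY y) (𝓝[<] stripYT T) (𝓝 (betaY (stripYT T))) := by
    have hc : ContinuousAt (fun y : ℝ => betaY y) (stripYT T) := by
      unfold betaY
      have hne : Real.sqrt 2 * stripYT T ≠ 0 := by positivity
      exact ((continuous_const.sub continuous_id).continuousAt).div
        ((continuous_const.mul continuous_id).continuousAt) hne
    exact hc.tendsto.mono_left nhdsWithin_le_nhds
  have := (h0.sub hβ).div_const (Real.cos (3 * Real.pi / 8))
  simpa using this

end Literature.Probability.RandomPlanarGeometry.SAW.HV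

/- ═════ ONE-CAR edition: begin PART V «ARCH-COEFFICIENTS» AC ed.1 ff3f68259c53d8a5 (a-p2 g11) — body VERBATIM (imports hoisted) ═════ -/

/-!
# `A_T(x_c; y)` as a power series in `y`: `y_T` is its radius of convergence (BBdGDCG14 Corollary 8, the arch series)

Topic `Literature/Probability/RandomPlanarGeometry` (continues `HexSAWStripSurfaceArchRadius.lean` — for `y > y_T` the arch class
`L ↦ A_{T,L}(x_c; y)` is unbounded (`HV.not_bddAbove_stripGFy_alpha_of_stripYT_lt`); away from `y*`, bounded arches ⇔ bounded bridges
(`HV.mem_stripBddSet_iff_bddAbove_alpha`) —, `HexSAWStripSurfaceThresholdClasses.lean` (`HV.bddAbove_stripGFy_alpha_of_lt_stripYT`: bounded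
for `0 ≤ y < y_T`) and `HexSAWStripSurfaceLimits.lean` (`HV.stripAyLim T y = sup_L A_{T,L}(x_c; y)`, `HV.bddAbove_stripGFy_alpha` below `y*`).
It is the arch twin of `HexSAWStripSurfaceRadius.lean` (which does the same for the bridge series `B_T(x_c; y)`; proofs parallel).
Source: N. R. Beaton, M. Bousquet-Mélou, J. de Gier, H. Duminil-Copin, A. J. Guttmann, *The critical fugacity for surface adsorption of
self-avoiding walks on the honeycomb lattice is `1 + √2`*, Comm. Math. Phys. 326 (2014) 727–754, arXiv:1109.0358v5, §3.2, Corollary 8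
(p. 12): "The series (in `y`) `A_T(x_c, y)`, `B_T(x_c, y)` and `C_T(x_c, y)` have radius of convergence `y_T`".

Write `A_{T,L}(x_c; y) = Σ_m α_{T,L,m} y^m` (`HV.stripAcoeffY`, `HV.hasSum_stripAcoeffY`), `α_{T,m} := sup_L α_{T,L,m}` (`HV.stripAcoeff`; the
coefficients increase with `L` and are bounded by `A_{T,L}(x_c; 1) ≤ 1/cos(3π/8)`), `A_T(x_c; y) := Σ_m α_{T,m} y^m`.  Then for `T ≥ 1`:

* `hasSum_stripAcoeff_of_bddAbove` — wherever `L ↦ A_{T,L}(x_c; y)` is bounded (`y ≥ 0`) the series converges, with sum `HV.stripAyLim T y`;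
  `not_summable_stripAcoeff` — wherever it is unbounded the series diverges; `summable_stripAcoeff_iff_bddAbove`;
* `hasSum_stripAcoeff_of_lt_stripYT`, `stripAyLim_eq_tsum_of_lt_stripYT` — inside the radius: for `0 ≤ y < y_T`, `A_T(x_c; y) = Σ_m α_{T,m} y^m`;
* ★ `not_summable_stripAcoeff_of_stripYT_lt` — outside: for `y > y_T` the series diverges;
* ★ **`stripYT_eq_sSup_summable_alpha`** — `y_T = sup {y ≥ 0 : Σ_m α_{T,m} y^m converges}`: the lane's `y_T` IS the radius of
  convergence of the arch series — the printed sentence for `A_T`, as a statement about a power series.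

(At `y = y_T` itself the series diverges too; that needs `y_T ∉ stripBddSet T` of the lane's «THRESHOLD-DIVERGENCE» file and is not used here.)
Label: CONSOLIDATION BY A DIFFERENT PROOF (bookkeeping: the printed power-series reading of the arch series, radius from the surgery file
rather than from rationality).  Lane «pcv-sawmu», a-p2 g11, 2026-08-23.
-/

noncomputable section

open Finset Filter Topology

namespace Literature.Probability.RandomPlanarGeometry.SAW.HV

variable {T : ℕ} {y : ℝ}

/-! ### The coefficients of `A_{T,L}(x_c; y)` as a polynomial in `y` -/

/-- `α_{T,L,m} := Σ_{γ ∈ arches of S_{T,L}, c(γ) = m} x_c^{|γ|}`, the coefficient of `y^m` in `A_{T,L}(x_c; y)`.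
[cite: BeatonBousquetMelouDeGierDuminilCopinGuttmann2014, §2 eq. (10) (arXiv v5 p. 6: A_{T,L}(x; y)); Corollary 8 (p. 12)] -/
def stripAcoeffY (T L m : ℕ) : ℝ :=
  ∑ P ∈ ((midWalks (stripV T L)).filter (fun P => IsAlphaDart (finalDart P))).filter (fun P => surfContacts T P = m),
    hexCriticalFugacity ^ mwLen P

/-- `α_{T,L,m} ≥ 0`. [cite: BeatonBousquetMelouDeGierDuminilCopinGuttmann2014, §2 eq. (10) (arXiv v5 p. 6)] -/
theorem stripAcoeffY_nonneg (T L m : ℕ) : 0 ≤ stripAcoeffY T L m :=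
  sum_nonneg fun _ _ => pow_nonneg hexCriticalFugacity_pos_lt_one.1.le _

/-- `α_{T,L,m}` increases with `L`. [cite: BeatonBousquetMelouDeGierDuminilCopinGuttmann2014, §4.2 (arXiv v5 p. 14: "they increase with L")] -/
theorem stripAcoeffY_mono_L {T L L' : ℕ} (h : L ≤ L') (m : ℕ) : stripAcoeffY T L m ≤ stripAcoeffY T L' m := by
  unfold stripAcoeffY
  exact sum_le_sum_of_subset_of_nonneg
    (filter_subset_filter _ (filter_subset_filter _ (midWalks_mono (stripV_mono_L h))))
    fun _ _ _ => pow_nonneg hexCriticalFugacity_pos_lt_one.1.le _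

/-- **`A_{T,L}(x_c; y) = Σ_m α_{T,L,m} y^m`** (a polynomial in `y` with nonnegative coefficients).
[cite: BeatonBousquetMelouDeGierDuminilCopinGuttmann2014, §2 eq. (10) (arXiv v5 p. 6: "the polynomials A_{T,L}, B_{T,L} and E_{T,L}", p. 7)] -/
theorem hasSum_stripAcoeffY (T L : ℕ) (y : ℝ) :
    HasSum (fun m => stripAcoeffY T L m * y ^ m) (stripGFy T L IsAlphaDart y) := by
  set W := (midWalks (stripV T L)).filter (fun P => IsAlphaDart (finalDart P)) with hW
  have h1 : stripGFy T L IsAlphaDart y = ∑ m ∈ W.image (surfContacts T), stripAcoeffY T L m * y ^ m := by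
    rw [stripGFy, ← hW, ← Finset.sum_fiberwise_of_maps_to (g := surfContacts T) (t := W.image (surfContacts T))
      (fun P hP => mem_image_of_mem _ hP)]
    refine sum_congr rfl fun m _ => ?_
    rw [stripAcoeffY, ← hW, sum_mul]
    refine sum_congr rfl fun P hP => ?_
    rw [(mem_filter.1 hP).2]
  rw [h1]
  refine hasSum_sum_of_ne_finset_zero fun m hm => ?_
  have h0 : stripAcoeffY T L m = 0 := by
    rw [stripAcoeffY, ← hW]
    exact sum_eq_zero fun P hP => (hm (mem_image.2 ⟨P, (mem_filter.1 hP).1, (mem_filter.1 hP).2⟩)).elim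
  rw [h0, zero_mul]

/-- `α_{T,L,m} ≤ A_{T,L}(x_c; 1)`. [cite: BeatonBousquetMelouDeGierDuminilCopinGuttmann2014, §2 eq. (10) (arXiv v5 p. 6)] -/
theorem stripAcoeffY_le_stripGFy_one (T L m : ℕ) : stripAcoeffY T L m ≤ stripGFy T L IsAlphaDart 1 := by
  have h := le_hasSum (hasSum_stripAcoeffY T L 1) m fun j _ => by
    simpa using stripAcoeffY_nonneg T L j
  simpa using h

/-- The coefficients are bounded in `L` (`T ≥ 1`; by the `y = 1 < y*` bound on the arches).
[cite: BeatonBousquetMelouDeGierDuminilCopinGuttmann2014, §4.2 (arXiv v5 p. 14: A_{T,L}(x_c; y) bounded in L)] -/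
theorem bddAbove_stripAcoeffY (hT : 1 ≤ T) (m : ℕ) : BddAbove (Set.range fun L : ℕ => stripAcoeffY T L m) := by
  have h1 : (1 : ℝ) < 1 + Real.sqrt 2 := by have := Real.sqrt_pos.2 (show (0 : ℝ) < 2 by norm_num); linarith
  obtain ⟨K, hK⟩ := bddAbove_stripGFy_alpha hT one_pos h1
  exact ⟨K, by rintro _ ⟨L, rfl⟩; exact (stripAcoeffY_le_stripGFy_one T L m).trans (hK ⟨L, rfl⟩)⟩

/-! ### The coefficients `α_{T,m}` of `A_T(x_c; y)` -/

/-- **`α_{T,m} := sup_L α_{T,L,m}`**, the coefficient of `y^m` in `A_T(x_c; y)` (monotone limit in the box length).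
[cite: BeatonBousquetMelouDeGierDuminilCopinGuttmann2014, Corollary 8 (arXiv v5 p. 12: "The series (in y) A_T(x_c, y) … have radius of convergence y_T")] -/
def stripAcoeff (T m : ℕ) : ℝ := ⨆ L : ℕ, stripAcoeffY T L m

/-- `α_{T,L,m} → α_{T,m}` as `L → ∞` (`T ≥ 1`). [cite: BeatonBousquetMelouDeGierDuminilCopinGuttmann2014, Corollary 8 (arXiv v5 p. 12)] -/
theorem tendsto_stripAcoeffY (hT : 1 ≤ T) (m : ℕ) :
    Tendsto (fun L : ℕ => stripAcoeffY T L m) atTop (𝓝 (stripAcoeff T m)) :=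
  tendsto_atTop_ciSup (fun _ _ h => stripAcoeffY_mono_L h m) (bddAbove_stripAcoeffY hT m)

/-- `α_{T,L,m} ≤ α_{T,m}`. [cite: BeatonBousquetMelouDeGierDuminilCopinGuttmann2014, Corollary 8 (arXiv v5 p. 12)] -/
theorem stripAcoeffY_le_stripAcoeff (hT : 1 ≤ T) (L m : ℕ) : stripAcoeffY T L m ≤ stripAcoeff T m :=
  le_ciSup (bddAbove_stripAcoeffY hT m) L

/-- `α_{T,m} ≥ 0`. [cite: BeatonBousquetMelouDeGierDuminilCopinGuttmann2014, Corollary 8 (arXiv v5 p. 12)] -/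
theorem stripAcoeff_nonneg (hT : 1 ≤ T) (m : ℕ) : 0 ≤ stripAcoeff T m :=
  (stripAcoeffY_nonneg T 0 m).trans (stripAcoeffY_le_stripAcoeff hT 0 m)

/-- Every `A_{T,L}(x_c; y)` lies below `Σ_m α_{T,m} y^m` whenever the latter converges (`y ≥ 0`).
[cite: BeatonBousquetMelouDeGierDuminilCopinGuttmann2014, Corollary 8 (arXiv v5 p. 12)] -/
theorem stripGFy_alpha_le_tsum_stripAcoeff (hT : 1 ≤ T) (hy0 : 0 ≤ y) (hs : Summable fun m => stripAcoeff T m * y ^ m) (L : ℕ) :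
    stripGFy T L IsAlphaDart y ≤ ∑' m, stripAcoeff T m * y ^ m :=
  hasSum_le (fun m => mul_le_mul_of_nonneg_right (stripAcoeffY_le_stripAcoeff hT L m) (pow_nonneg hy0 m))
    (hasSum_stripAcoeffY T L y) hs.hasSum

/-! ### Convergence exactly where the arch class is bounded -/

/-- **Convergence with the value**: if `L ↦ A_{T,L}(x_c; y)` is bounded (`y ≥ 0`, `T ≥ 1`) the series `Σ_m α_{T,m} y^m` converges and
its sum is `A_T(x_c; y) = sup_L A_{T,L}(x_c; y)` (`HV.stripAyLim`).
[cite: BeatonBousquetMelouDeGierDuminilCopinGuttmann2014, Corollary 8 (arXiv v5 p. 12) and §4.2 (p. 14)] -/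
theorem hasSum_stripAcoeff_of_bddAbove (hT : 1 ≤ T) (hy0 : 0 ≤ y)
    (hbdd : BddAbove (Set.range fun L : ℕ => stripGFy T L IsAlphaDart y)) :
    HasSum (fun m => stripAcoeff T m * y ^ m) (stripAyLim T y) := by
  have hf0 : ∀ m, 0 ≤ stripAcoeff T m * y ^ m := fun m => mul_nonneg (stripAcoeff_nonneg hT m) (pow_nonneg hy0 m)
  have hpart : ∀ n, ∑ m ∈ Finset.range n, stripAcoeff T m * y ^ m ≤ stripAyLim T y := by
    intro n
    have hlim : Tendsto (fun L : ℕ => ∑ m ∈ Finset.range n, stripAcoeffY T L m * y ^ m) atTop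
        (𝓝 (∑ m ∈ Finset.range n, stripAcoeff T m * y ^ m)) :=
      tendsto_finsetSum _ fun m _ => (tendsto_stripAcoeffY hT m).mul_const _
    refine le_of_tendsto' hlim fun L => ?_
    calc ∑ m ∈ Finset.range n, stripAcoeffY T L m * y ^ m ≤ stripGFy T L IsAlphaDart y :=
          sum_le_hasSum (Finset.range n) (fun m _ => mul_nonneg (stripAcoeffY_nonneg T L m) (pow_nonneg hy0 m))
            (hasSum_stripAcoeffY T L y)
      _ ≤ stripAyLim T y := le_ciSup hbdd L
  have hsum : Summable fun m => stripAcoeff T m * y ^ m := summable_of_sum_range_le hf0 hpart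
  have h1 : ∑' m, stripAcoeff T m * y ^ m ≤ stripAyLim T y := Real.tsum_le_of_sum_range_le hf0 hpart
  have h2 : stripAyLim T y ≤ ∑' m, stripAcoeff T m * y ^ m := by
    unfold stripAyLim
    exact ciSup_le fun L => stripGFy_alpha_le_tsum_stripAcoeff hT hy0 hsum L
  have h3 : stripAyLim T y = ∑' m, stripAcoeff T m * y ^ m := le_antisymm h2 h1
  rw [h3]
  exact hsum.hasSum

/-- **Divergence where the arch class is unbounded** (`y ≥ 0`, `T ≥ 1`).
[cite: BeatonBousquetMelouDeGierDuminilCopinGuttmann2014, Corollary 8 (arXiv v5 p. 12)] -/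
theorem not_summable_stripAcoeff (hT : 1 ≤ T) (hy0 : 0 ≤ y)
    (hnb : ¬ BddAbove (Set.range fun L : ℕ => stripGFy T L IsAlphaDart y)) :
    ¬ Summable fun m => stripAcoeff T m * y ^ m := fun hs =>
  hnb ⟨∑' m, stripAcoeff T m * y ^ m, by
    rintro _ ⟨L, rfl⟩
    exact stripGFy_alpha_le_tsum_stripAcoeff hT hy0 hs L⟩

/-- `Σ_m α_{T,m} y^m` converges iff the arch class is bounded in `L` (`y ≥ 0`, `T ≥ 1`).
[cite: BeatonBousquetMelouDeGierDuminilCopinGuttmann2014, Corollary 8 (arXiv v5 p. 12)] -/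
theorem summable_stripAcoeff_iff_bddAbove (hT : 1 ≤ T) (hy0 : 0 ≤ y) :
    (Summable fun m => stripAcoeff T m * y ^ m) ↔ BddAbove (Set.range fun L : ℕ => stripGFy T L IsAlphaDart y) :=
  ⟨fun hs => by_contra fun hnb => not_summable_stripAcoeff hT hy0 hnb hs, fun hb => (hasSum_stripAcoeff_of_bddAbove hT hy0 hb).summable⟩

/-! ### `y_T` = the radius of convergence of the arch series -/

/-- **Inside the radius**: for `0 ≤ y < y_T`, `Σ_m α_{T,m} y^m` converges to `A_T(x_c; y)`.
[cite: BeatonBousquetMelouDeGierDuminilCopinGuttmann2014, Corollary 8 (arXiv v5 p. 12)] -/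
theorem hasSum_stripAcoeff_of_lt_stripYT (hT : 1 ≤ T) (hy0 : 0 ≤ y) (h : y < stripYT T) :
    HasSum (fun m => stripAcoeff T m * y ^ m) (stripAyLim T y) :=
  hasSum_stripAcoeff_of_bddAbove hT hy0 (bddAbove_stripGFy_alpha_of_lt_stripYT hT hy0 h)

/-- Inside the radius, `A_T(x_c; y) = Σ_m α_{T,m} y^m`. [cite: BeatonBousquetMelouDeGierDuminilCopinGuttmann2014, Corollary 8 (arXiv v5 p. 12)] -/
theorem stripAyLim_eq_tsum_of_lt_stripYT (hT : 1 ≤ T) (hy0 : 0 ≤ y) (h : y < stripYT T) :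
    stripAyLim T y = ∑' m, stripAcoeff T m * y ^ m :=
  (hasSum_stripAcoeff_of_lt_stripYT hT hy0 h).tsum_eq.symm

/-- ★ **Outside the radius**: for `y > y_T` the arch series diverges (the surgery file's unbounded arch class).
[cite: BeatonBousquetMelouDeGierDuminilCopinGuttmann2014, Corollary 8 (arXiv v5 p. 12); lane: via the ε-walk → arch surgery] -/
theorem not_summable_stripAcoeff_of_stripYT_lt (hT : 1 ≤ T) (h : stripYT T < y) :
    ¬ Summable fun m => stripAcoeff T m * y ^ m :=
  not_summable_stripAcoeff hT ((yStar_pos.le.trans (yStar_le_stripYT hT)).trans h.le)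
    (not_bddAbove_stripGFy_alpha_of_stripYT_lt hT h)

/-- ★ **`y_T` is the radius of convergence of the arch series**: `stripYT T = sup {y ≥ 0 : Σ_m α_{T,m} y^m converges}` (`T ≥ 1`) — the
printed sentence "`A_T(x_c, y)` has radius of convergence `y_T`", for the lane's `y_T`, as a statement about a genuine power series.
[cite: BeatonBousquetMelouDeGierDuminilCopinGuttmann2014, Corollary 8 (arXiv v5 p. 12: "The series (in y) A_T(x_c, y), B_T(x_c, y) and C_T(x_c, y) have radius of convergence y_T"); lane] -/
theorem stripYT_eq_sSup_summable_alpha (hT : 1 ≤ T) :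
    stripYT T = sSup {y : ℝ | 0 ≤ y ∧ Summable fun m => stripAcoeff T m * y ^ m} := by
  set S := {y : ℝ | 0 ≤ y ∧ Summable fun m => stripAcoeff T m * y ^ m} with hS
  have hyT : 0 < stripYT T := yStar_pos.trans_le (yStar_le_stripYT hT)
  -- S ⊆ [0, y_T] and [0, y_T) ⊆ S
  have hup : ∀ y ∈ S, y ≤ stripYT T := fun y hy =>
    le_of_not_gt fun hlt => not_summable_stripAcoeff_of_stripYT_lt hT hlt hy.2
  have hlow : ∀ y, 0 ≤ y → y < stripYT T → y ∈ S := fun y hy0 hlt =>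
    ⟨hy0, (hasSum_stripAcoeff_of_lt_stripYT hT hy0 hlt).summable⟩
  have hne : S.Nonempty := ⟨0, hlow 0 le_rfl hyT⟩
  refine le_antisymm ?_ (csSup_le hne hup)
  -- y_T ≤ sup S: every y < y_T lies in S
  refine le_of_forall_lt fun c hc => ?_
  rcases lt_or_ge c 0 with hc0 | hc0
  · exact hc0.trans_le (le_csSup ⟨stripYT T, hup⟩ (hlow 0 le_rfl hyT))
  · set c' := (c + stripYT T) / 2 with hc'
    have h1 : c < c' := by rw [hc']; linarith
    have h2 : c' < stripYT T := by rw [hc']; linarith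
    exact h1.trans_le (le_csSup ⟨stripYT T, hup⟩ (hlow c' (by rw [hc']; linarith) h2))

end Literature.Probability.RandomPlanarGeometry.SAW.HV

/- ═════ ONE-CAR edition: begin PART VI «SERIES-CONTINUITY» SC ed.2 08341af99213b1f8 (a-p2 g11/g12) — body VERBATIM (imports hoisted) ═════ -/

/-!
# `A_T(x_c; ·)` and `B_T(x_c; ·)` are continuous inside their radius `y_T` (BBdGDCG14, Corollary 8: power series inside the radius)

Topic `Literature/Probability/RandomPlanarGeometry` (continues `HexSAWStripSurfaceRadius.lean` — `B_T(x_c; y) = Σ_m β_{T,m} y^m` on the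
boundedness set (`HV.hasSum_stripBcoeff_of_mem`, `HV.stripByLim_eq_tsum`, `HV.summable_stripBcoeff_of_lt_stripYT`) — and
`HexSAWStripSurfaceArchCoefficients.lean` — `A_T(x_c; y) = Σ_m α_{T,m} y^m` for `0 ≤ y < y_T` (`HV.hasSum_stripAcoeff_of_lt_stripYT`)).
Source: N. R. Beaton, M. Bousquet-Mélou, J. de Gier, H. Duminil-Copin, A. J. Guttmann, *The critical fugacity for surface adsorption of
self-avoiding walks on the honeycomb lattice is `1 + √2`*, Comm. Math. Phys. 326 (2014) 727–754, arXiv:1109.0358v5, Corollary 8 (p. 12: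
"The series (in `y`) `A_T(x_c, y)`, `B_T(x_c, y)` and `C_T(x_c, y)` have radius of convergence `y_T`") — in print these are power
series, hence continuous inside their disc of convergence; the tree's `HV.stripAyLim` / `HV.stripByLim` are suprema over `L` of
polynomials, and this file derives their continuity on `[0, y_T)` from the power-series representations (Weierstrass M-test on `[0, r]`,
`r < y_T`).  The lane's `HexSAWStripSurfaceLeftContinuity.lean` (a-idea-1) proved LEFT-continuity by a supremum argument; here both sides.

## Main statements (namespace `Literature.Probability.RandomPlanarGeometry.SAW.HV`; `T ≥ 1`; standard axioms)

* `continuousOn_stripByLim_Icc`, `continuousOn_stripAyLim_Icc` — continuity on every `[0, r]`, `r < y_T`;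
* **`continuousOn_stripByLim`**, **`continuousOn_stripAyLim`** — `B_T(x_c; ·)`, `A_T(x_c; ·)` are continuous on `[0, y_T)`;
* **`continuousAt_stripByLim`**, **`continuousAt_stripAyLim`** — and continuous (two-sided) at every `0 < y < y_T`.

Label: CONSOLIDATION (plumbing of the printed power-series reading).  Lane «pcv-sawmu», a-p2 g11, 2026-08-23.
-/

noncomputable section

open Finset Filter Topology

namespace Literature.Probability.RandomPlanarGeometry.SAW.HV

variable {T : ℕ}

/-- Weierstrass M-test for a nonnegative power series on `[0, r]`: if `Σ_m c_m r^m` converges (`c_m ≥ 0`, `r ≥ 0`) then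
`y ↦ Σ_m c_m y^m` is continuous on `[0, r]`. [cite: BeatonBousquetMelouDeGierDuminilCopinGuttmann2014, Corollary 8 (arXiv v5 p. 12: power series inside the radius); classical M-test] -/
private theorem continuousOn_tsum_pow_Icc {c : ℕ → ℝ} (hc : ∀ m, 0 ≤ c m) {r : ℝ}
    (hs : Summable fun m => c m * r ^ m) :
    ContinuousOn (fun y : ℝ => ∑' m, c m * y ^ m) (Set.Icc 0 r) := by
  refine continuousOn_tsum (fun m => (continuous_const.mul (continuous_pow m)).continuousOn) hs fun m y hy => ?_
  rw [Real.norm_eq_abs, abs_of_nonneg (mul_nonneg (hc m) (pow_nonneg hy.1 m))]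
  exact mul_le_mul_of_nonneg_left (pow_le_pow_left₀ hy.1 hy.2 m) (hc m)

/-! ### The bridge series -/

/-- **`B_T(x_c; ·)` is continuous on `[0, r]` for every `r < y_T`** (`r ≥ 0`, `T ≥ 1`).
[cite: BeatonBousquetMelouDeGierDuminilCopinGuttmann2014, Corollary 8 (arXiv v5 p. 12: B_T(x_c; y) has radius of convergence y_T)] -/
theorem continuousOn_stripByLim_Icc (hT : 1 ≤ T) {r : ℝ} (hr0 : 0 ≤ r) (hr : r < stripYT T) :
    ContinuousOn (stripByLim T) (Set.Icc 0 r) := by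
  have hc := continuousOn_tsum_pow_Icc (stripBcoeff_nonneg hT) (summable_stripBcoeff_of_lt_stripYT hT hr0 hr)
  refine hc.congr fun y hy => ?_
  exact stripByLim_eq_tsum hT (mem_stripBddSet_of_lt_stripYT hT hy.1 (hy.2.trans_lt hr))

/-- **`B_T(x_c; ·)` is continuous on `[0, y_T)`** (`T ≥ 1`). [cite: BeatonBousquetMelouDeGierDuminilCopinGuttmann2014, Corollary 8 (arXiv v5 p. 12)] -/
theorem continuousOn_stripByLim (hT : 1 ≤ T) : ContinuousOn (stripByLim T) (Set.Ico 0 (stripYT T)) := by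
  intro y hy
  set r := (y + stripYT T) / 2 with hr
  have hyr : y < r := by rw [hr]; linarith [hy.2]
  have hrT : r < stripYT T := by rw [hr]; linarith [hy.2]
  have hr0 : 0 ≤ r := by rw [hr]; linarith [hy.1, hy.2]
  have h := (continuousOn_stripByLim_Icc hT hr0 hrT) y ⟨hy.1, hyr.le⟩
  refine h.mono_of_mem_nhdsWithin ?_
  -- `[0, r]` is a neighbourhood of `y` within `[0, y_T)`
  refine mem_nhdsWithin.2 ⟨Set.Iio r, isOpen_Iio, hyr, ?_⟩
  rintro z ⟨hz1, hz2⟩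
  exact ⟨hz2.1, (le_of_lt hz1)⟩

/-- **`B_T(x_c; ·)` is continuous at every `0 < y < y_T`** (`T ≥ 1`). [cite: BeatonBousquetMelouDeGierDuminilCopinGuttmann2014, Corollary 8 (arXiv v5 p. 12)] -/
theorem continuousAt_stripByLim (hT : 1 ≤ T) {y : ℝ} (hy0 : 0 < y) (hy : y < stripYT T) : ContinuousAt (stripByLim T) y := by
  set r := (y + stripYT T) / 2 with hr
  have hyr : y < r := by rw [hr]; linarith
  have hrT : r < stripYT T := by rw [hr]; linarith
  exact (continuousOn_stripByLim_Icc hT (hy0.le.trans hyr.le) hrT).continuousAt (Icc_mem_nhds hy0 hyr)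

/-! ### The arch series -/

/-- **`A_T(x_c; ·)` is continuous on `[0, r]` for every `r < y_T`** (`r ≥ 0`, `T ≥ 1`).
[cite: BeatonBousquetMelouDeGierDuminilCopinGuttmann2014, Corollary 8 (arXiv v5 p. 12: A_T(x_c; y) has radius of convergence y_T)] -/
theorem continuousOn_stripAyLim_Icc (hT : 1 ≤ T) {r : ℝ} (hr0 : 0 ≤ r) (hr : r < stripYT T) :
    ContinuousOn (stripAyLim T) (Set.Icc 0 r) := by
  have hc := continuousOn_tsum_pow_Icc (stripAcoeff_nonneg hT) (hasSum_stripAcoeff_of_lt_stripYT hT hr0 hr).summable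
  refine hc.congr fun y hy => ?_
  exact stripAyLim_eq_tsum_of_lt_stripYT hT hy.1 (hy.2.trans_lt hr)

/-- **`A_T(x_c; ·)` is continuous on `[0, y_T)`** (`T ≥ 1`). [cite: BeatonBousquetMelouDeGierDuminilCopinGuttmann2014, Corollary 8 (arXiv v5 p. 12)] -/
theorem continuousOn_stripAyLim (hT : 1 ≤ T) : ContinuousOn (stripAyLim T) (Set.Ico 0 (stripYT T)) := by
  intro y hy
  set r := (y + stripYT T) / 2 with hr
  have hyr : y < r := by rw [hr]; linarith [hy.2]
  have hrT : r < stripYT T := by rw [hr]; linarith [hy.2]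
  have hr0 : 0 ≤ r := by rw [hr]; linarith [hy.1, hy.2]
  have h := (continuousOn_stripAyLim_Icc hT hr0 hrT) y ⟨hy.1, hyr.le⟩
  refine h.mono_of_mem_nhdsWithin ?_
  refine mem_nhdsWithin.2 ⟨Set.Iio r, isOpen_Iio, hyr, ?_⟩
  rintro z ⟨hz1, hz2⟩
  exact ⟨hz2.1, (le_of_lt hz1)⟩

/-- **`A_T(x_c; ·)` is continuous at every `0 < y < y_T`** (`T ≥ 1`). [cite: BeatonBousquetMelouDeGierDuminilCopinGuttmann2014, Corollary 8 (arXiv v5 p. 12)] -/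
theorem continuousAt_stripAyLim (hT : 1 ≤ T) {y : ℝ} (hy0 : 0 < y) (hy : y < stripYT T) : ContinuousAt (stripAyLim T) y := by
  set r := (y + stripYT T) / 2 with hr
  have hyr : y < r := by rw [hr]; linarith
  have hrT : r < stripYT T := by rw [hr]; linarith
  exact (continuousOn_stripAyLim_Icc hT (hy0.le.trans hyr.le) hrT).continuousAt (Icc_mem_nhds hy0 hyr)

/-! ### The arch series `A_T(x_c; y) = Σ_m α_{T,m} y^m`: converges iff `y < y_T`, diverges AT `y_T`
(moved here verbatim from «THRESHOLD-DIVERGENCE» ed.5, whose AC-free ed.4 is PART 3 of `HexSAWStripSurfaceThresholdRate.lean`) -/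

/-- **`A_T(x_c; y) = Σ_m α_{T,m} y^m` converges iff `y < y_T`** (`0 ≤ y`, `T ≥ 1`).
[cite: BeatonBousquetMelouDeGierDuminilCopinGuttmann2014, Corollary 8 (arXiv v5 p. 12: "radius of convergence y_T")] -/
theorem summable_stripAcoeff_iff_lt_stripYT (hT : 1 ≤ T) {y : ℝ} (hy0 : 0 ≤ y) :
    (Summable fun m => stripAcoeff T m * y ^ m) ↔ y < stripYT T := by
  rw [summable_stripAcoeff_iff_bddAbove hT hy0, bddAbove_stripGFy_alpha_iff_lt_stripYT hT hy0]

/-- ★ **The arch series diverges AT its radius**: `Σ_m α_{T,m} y_T^m = ∞` (`T ≥ 1`).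
[cite: BeatonBousquetMelouDeGierDuminilCopinGuttmann2014, Corollary 8 (arXiv v5 p. 12); lane: divergence at the radius by growth rates + the surgery] -/
theorem not_summable_stripAcoeff_stripYT (hT : 1 ≤ T) : ¬ Summable fun m => stripAcoeff T m * stripYT T ^ m :=
  not_summable_stripAcoeff hT (stripYT_pos hT).le (not_bddAbove_stripGFy_alpha_stripYT hT)

end Literature.Probability.RandomPlanarGeometry.SAW.HV
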